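import Literature.NumberTheory.Sieve.MoebiusShiftedPrimesMeanSquare33
import HarnessLib

/-!
# Möbius on shifted primes — the major arcs of Lichtman 2020 at the printed first exponent (sub-windows)

Topic `Literature/NumberTheory/Sieve`, part of the decomposition of the named fact
`Literature.NumberTheory.Sieve.Lichtman2020_keyFourierEstimateLiouville` (J. D. Lichtman, *Averages of
the Möbius function on shifted primes*, Q. J. Math. 73 (2022) 729–757, arXiv:2009.08969v2
[Lichtman2020], Proposition 2.3 AS PRINTED: typical set with first interval
`[(log X)^{33A}, H/(log X)^{4A}]`, hypothesis `ψ(X) ≤ (log X)^{2/3}`), third layer after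
`MoebiusShiftedPrimesDirichletMeanValue33.lean` (Proposition 5.1 at the printed `P₁`, saving
`(log X)^{-3A}`) and `MoebiusShiftedPrimesMeanSquare33.lean` (Proposition 3.4 at every window length).
Page numbers refer to the held copy `paper:arxiv-2009.08969`.

* `Lichtman2020.majorArc33` — PROVED from `Lichtman2020_primeCharacterSum` (Lemma 4.5) and
  `Lichtman2020_liouvilleCharacterSifted` (Lemma 4.8, proved in the tree): for `c ≥ 33`, `A > 5`,
  `δ > 0`, `ψ → ∞`, `ψ(X) ≤ (log X)^{2/3}`, eventually in `X`, for `1 ≤ d ≤ W = (log X)^A` and `α` in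
  the printed major arcs `𝔐 = ⋃_{q ≤ W} 𝔐(q)` (`|α - a/q| ≤ 1/(qQ₁)`, `Q₁ = H/W⁴`):
  `∫₀^X |∑_{x ≤ nd ≤ x+H, n ∈ S_c} λ(n) e(nα)| dx ≤ C · HX/(d W^{1/5})`.

This is WEAKER than the printed Proposition 3.2 (`HX/(dW)`) but is all that Proposition 2.3 needs
(`HX/(d^{3/4}W^{1/5})`), and it is what the printed `P₁` affords: the printed deduction (pp. 10–11)
loses the factor `W⁴/q` of the arc width by Abel summation in `e(mθ)` ((3.9)) and therefore needs
Proposition 3.4 with the saving `W^{-10}`, i.e. `B = 11A` in Proposition 5.1, which the printed method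
does not give at `P₁ = (log X)^{33A}` (module docstring of `MoebiusShiftedPrimesTypical.lean`).  Here
instead each window `{m : x ≤ md ≤ x+H}` is cut into sub-windows of `h` consecutive integers,
`h = ⌊W^{-1/5}/|θ|⌋` (`α = a/q + θ`), on which `e(mθ)` is constant up to `2πh|θ| ≤ 2πW^{-1/5}`: no
factor `W⁴/q` is lost, and the mean-square saving `(log X)^{-3A} = W^{-3}` of the previous layers at
the window lengths `h ≥ W^{-1/5} qH/W⁴` (where `Q₁/h ≤ W^{1/5}`) gives `W^{-1/5}` after the residues
`(mod q)`, the characters and the dyadic Cauchy–Schwarz of pp. 10–11 (`majorArc_fixed_bound33`,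
`majorArc33_numerics`).

## Contents (all PROVED)

* `norm_sum_window_le_pieces` (sub-windows with phase removal), `sum_twistedWindow_le33`
  (residues, gcd, characters, divided windows, dyadic Cauchy–Schwarz with a length-dependent
  mean-square input; the tree's `sum_twistedWindow_le` for the printed ranges),
  `majorArc_fixed_bound33` (the bound at a fixed `X`, constant `16 + 8π + 52√C`),
  `majorArc33_numerics` and its satellites (real arithmetic), `Lichtman2020.majorArc33`.
* No new definition of `Prop` type and no named fact is introduced.

## Source

* J. D. Lichtman, arXiv:2009.08969v2, §3.2: Propositions 3.2, 3.4 and "Proof of Proposition 3.2 from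
  Proposition 3.4", (3.8)–(3.13), pp. 10–11 [Lichtman2020] (the sub-window variant of (3.9) is ours;
  everything from (3.11) on is as printed).
-/

noncomputable section

namespace Literature.NumberTheory.Sieve.Lichtman2020

open Finset Filter
open scoped FourierTransform Topology

/-! ### Sub-windows and phase removal -/

/-- **Phase removal on a piece**: for `|f| ≤ 1`,
`|∑_{v ≤ m ≤ v+ℓ} f(m) e(mθ)| ≤ |∑_{v ≤ m ≤ v+ℓ} f(m)| + (ℓ+1) · 2πℓ|θ|`, since
`|e(mθ) - e(vθ)| = |e((m-v)θ) - 1| ≤ 2π(m-v)|θ|`. [folklore] -/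
theorem norm_sum_Icc_mul_fourierChar_le_add (f : ℕ → ℂ) (hf : ∀ m, ‖f m‖ ≤ 1) (θ : ℝ) (v ℓ : ℕ) :
    ‖∑ m ∈ Icc v (v + ℓ), f m * (𝐞 ((m : ℝ) * θ) : ℂ)‖ ≤
      ‖∑ m ∈ Icc v (v + ℓ), f m‖ + ((ℓ : ℝ) + 1) * (2 * Real.pi * ℓ * |θ|) := by
  have hsplit : ∑ m ∈ Icc v (v + ℓ), f m * (𝐞 ((m : ℝ) * θ) : ℂ) =
      (𝐞 ((v : ℝ) * θ) : ℂ) * ∑ m ∈ Icc v (v + ℓ), f m +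
        ∑ m ∈ Icc v (v + ℓ), f m * ((𝐞 ((m : ℝ) * θ) : ℂ) - 𝐞 ((v : ℝ) * θ)) := by
    rw [Finset.mul_sum, ← Finset.sum_add_distrib]
    refine Finset.sum_congr rfl fun m _ => ?_
    ring
  rw [hsplit]
  refine (norm_add_le _ _).trans (add_le_add ?_ ?_)
  · rw [norm_mul, norm_fourierChar, one_mul]
  · refine (norm_sum_le _ _).trans ?_
    have hterm : ∀ m ∈ Icc v (v + ℓ),
        ‖f m * ((𝐞 ((m : ℝ) * θ) : ℂ) - 𝐞 ((v : ℝ) * θ))‖ ≤ 2 * Real.pi * ℓ * |θ| := by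
      intro m hm
      rw [Finset.mem_Icc] at hm
      obtain ⟨t, rfl⟩ := Nat.exists_eq_add_of_le hm.1
      have ht : t ≤ ℓ := by omega
      rw [norm_mul]
      have h1 : ‖(𝐞 (((v + t : ℕ) : ℝ) * θ) : ℂ) - 𝐞 ((v : ℝ) * θ)‖ ≤ 2 * Real.pi * ℓ * |θ| := by
        have e : (((v + t : ℕ) : ℝ) * θ) = (v : ℝ) * θ + (t : ℝ) * θ := by push_cast; ring
        rw [e, AddChar.map_add_eq_mul, Circle.coe_mul, ← mul_sub_one, norm_mul, norm_fourierChar,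
          one_mul]
        calc ‖(𝐞 ((t : ℝ) * θ) : ℂ) - 1‖ ≤ 2 * Real.pi * |(t : ℝ) * θ| := norm_fourierChar_sub_one_le _
          _ = 2 * Real.pi * t * |θ| := by rw [abs_mul, Nat.abs_cast]; ring
          _ ≤ 2 * Real.pi * ℓ * |θ| := by gcongr
      calc ‖f (v + t)‖ * ‖(𝐞 (((v + t : ℕ) : ℝ) * θ) : ℂ) - 𝐞 ((v : ℝ) * θ)‖
          ≤ 1 * (2 * Real.pi * ℓ * |θ|) := mul_le_mul (hf _) h1 (norm_nonneg _) zero_le_one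
        _ = 2 * Real.pi * ℓ * |θ| := one_mul _
    calc ∑ m ∈ Icc v (v + ℓ), ‖f m * ((𝐞 ((m : ℝ) * θ) : ℂ) - 𝐞 ((v : ℝ) * θ))‖
        ≤ ∑ m ∈ Icc v (v + ℓ), 2 * Real.pi * ℓ * |θ| := Finset.sum_le_sum hterm
      _ = ((ℓ : ℝ) + 1) * (2 * Real.pi * ℓ * |θ|) := by
          rw [Finset.sum_const, Nat.card_Icc, nsmul_eq_mul]
          push_cast [show v ≤ v + ℓ + 1 by omega]
          ring

/-- **The fibres of `m ↦ ⌊(m-u)/h⌋` on a window are sub-windows**: for `h ≥ 1`,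
`{m ∈ [u, u+n] : ⌊(m-u)/h⌋ = j} = [u + jh, u + min(jh + h - 1, n)]`. [folklore] -/
theorem Icc_filter_div_eq {h : ℕ} (hh : 0 < h) (u n j : ℕ) :
    (Icc u (u + n)).filter (fun m => (m - u) / h = j) = Icc (u + j * h) (u + min (j * h + h - 1) n) := by
  ext m
  rw [Finset.mem_filter, Finset.mem_Icc, Finset.mem_Icc]
  constructor
  · rintro ⟨⟨h1, h2⟩, h3⟩
    have h4 : j * h ≤ m - u := by rw [← h3]; exact Nat.div_mul_le_self _ _
    have h5 : m - u < (m - u) / h * h + h := Nat.lt_div_mul_add hh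
    rw [h3] at h5
    generalize j * h = J at h4 h5 ⊢
    omega
  · rintro ⟨h1, h2⟩
    have h1' : j * h ≤ m - u := by generalize j * h = J at h1 h2 ⊢; omega
    have h2' : m - u < (j + 1) * h := by
      rw [Nat.add_mul, one_mul]; generalize j * h = J at h1 h2 ⊢; omega
    refine ⟨⟨?_, ?_⟩, Nat.div_eq_of_lt_le h1' h2'⟩
    · generalize j * h = J at h1 h2 ⊢; omega
    · generalize j * h = J at h1 h2 ⊢; omega

/-- **Sub-window decomposition with phase removal**: for `|f| ≤ 1`, `h ≥ 1`, the window
`[u, u+n]` split into the `⌊n/h⌋ + 1` pieces `[u + jh, u + min(jh+h-1, n)]`: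
`|∑_{u ≤ m ≤ u+n} f(m)e(mθ)| ≤ ∑_j |∑_{piece j} f(m)| + (⌊n/h⌋ + 1) · h · 2πh|θ|`.
[cite: Lichtman2020, §3.2 (variant of (3.9): sub-windows instead of Abel summation)] -/
theorem norm_sum_window_le_pieces (f : ℕ → ℂ) (hf : ∀ m, ‖f m‖ ≤ 1) (θ : ℝ) (u n : ℕ) {h : ℕ}
    (hh : 0 < h) :
    ‖∑ m ∈ Icc u (u + n), f m * (𝐞 ((m : ℝ) * θ) : ℂ)‖ ≤
      ∑ j ∈ range (n / h + 1), ‖∑ m ∈ Icc (u + j * h) (u + min (j * h + h - 1) n), f m‖ +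
        ((n / h : ℕ) + 1 : ℝ) * ((h : ℝ) * (2 * Real.pi * h * |θ|)) := by
  -- group the window by the fibres of `m ↦ (m - u)/h`
  have hmaps : ∀ m ∈ Icc u (u + n), (m - u) / h ∈ range (n / h + 1) := by
    intro m hm
    rw [Finset.mem_Icc] at hm
    rw [Finset.mem_range, Nat.lt_succ_iff]
    exact Nat.div_le_div_right (by omega)
  rw [← Finset.sum_fiberwise_of_maps_to hmaps]
  refine (norm_sum_le _ _).trans ?_
  have hpiece : ∀ j ∈ range (n / h + 1),
      ‖∑ m ∈ (Icc u (u + n)).filter (fun m => (m - u) / h = j), f m * (𝐞 ((m : ℝ) * θ) : ℂ)‖ ≤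
        ‖∑ m ∈ Icc (u + j * h) (u + min (j * h + h - 1) n), f m‖ + (h : ℝ) * (2 * Real.pi * h * |θ|) := by
    intro j hj
    rw [Finset.mem_range, Nat.lt_succ_iff] at hj
    have hjn : j * h ≤ n := (Nat.mul_le_mul_right h hj).trans (Nat.div_mul_le_self n h)
    rw [Icc_filter_div_eq hh]
    -- the piece is `[v, v + ℓ]` with `v = u + jh`, `ℓ = min(jh+h-1, n) - jh ≤ h - 1`
    obtain ⟨ℓ, hℓ⟩ : ∃ ℓ : ℕ, ℓ = min (j * h + h - 1) n - j * h := ⟨_, rfl⟩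
    have hℓh : ℓ + 1 ≤ h := by
      rw [hℓ]
      have : min (j * h + h - 1) n ≤ j * h + h - 1 := min_le_left _ _
      generalize j * h = J at this hjn ⊢
      omega
    have hvℓ : u + min (j * h + h - 1) n = (u + j * h) + ℓ := by
      rw [hℓ]
      have : j * h ≤ min (j * h + h - 1) n := le_min (by generalize j * h = J; omega) hjn
      omega
    rw [hvℓ]
    refine (norm_sum_Icc_mul_fourierChar_le_add f hf θ (u + j * h) ℓ).trans ?_
    refine add_le_add le_rfl ?_
    have hℓ1 : (ℓ : ℝ) + 1 ≤ h := by exact_mod_cast hℓh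
    have hℓ2 : (ℓ : ℝ) ≤ h := by linarith
    have hpi : 0 ≤ 2 * Real.pi * |θ| := by positivity
    calc ((ℓ : ℝ) + 1) * (2 * Real.pi * ℓ * |θ|) = ((ℓ : ℝ) + 1) * ℓ * (2 * Real.pi * |θ|) := by ring
      _ ≤ (h : ℝ) * h * (2 * Real.pi * |θ|) := by
          refine mul_le_mul_of_nonneg_right ?_ hpi
          exact mul_le_mul hℓ1 hℓ2 (Nat.cast_nonneg _) (Nat.cast_nonneg _)
      _ = (h : ℝ) * (2 * Real.pi * h * |θ|) := by ring
  refine (Finset.sum_le_sum hpiece).trans (le_of_eq ?_)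
  rw [Finset.sum_add_distrib, Finset.sum_const, Finset.card_range, nsmul_eq_mul]
  push_cast
  ring

open ArithmeticFunction in
/-- **The plain-window sum of `λχ` on average, general mean-square input**: if the mean square over
every dyadic block `Y < m₀ ≤ 2Y`, `M₀ ≤ Y ≤ N`, of the window sums of length `ℓ + 1` is `≤ K Y`,
then `∑_{m₀ ≤ N} |∑_{m₀ ≤ m ≤ m₀+ℓ, m ∈ S} λ(m)χ(m)| ≤ (ℓ+1)M₀ + 2√K N` (trivial bound below `M₀`,
dyadic Cauchy–Schwarz above). [cite: Lichtman2020, §3.2, (3.13)] -/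
theorem sum_plainWindow_le33 {n : ℕ} (χ : DirichletCharacter ℂ n) (S : ℕ → Prop) [DecidablePred S]
    {ℓ M₀ N : ℕ} {K : ℝ} (hM : 1 ≤ M₀) (hK : 0 ≤ K)
    (hms : ∀ Y : ℕ, M₀ ≤ Y → Y ≤ N →
      ∑ k ∈ Ioc Y (2 * Y), ‖∑ m ∈ (Icc k (k + ℓ)).filter S,
          χ (m : ZMod n) * ((liouville m : ℤ) : ℂ)‖ ^ 2 ≤ K * Y) :
    ∑ m₀ ∈ Icc 1 N, ‖∑ m ∈ (Icc m₀ (m₀ + ℓ)).filter S, χ (m : ZMod n) * ((liouville m : ℤ) : ℂ)‖ ≤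
      ((ℓ : ℝ) + 1) * M₀ + 2 * Real.sqrt K * N := by
  have h := sum_Icc_le_of_dyadic (Q := fun m₀ => ‖∑ m ∈ (Icc m₀ (m₀ + ℓ)).filter S,
      χ (m : ZMod n) * ((liouville m : ℤ) : ℂ)‖) (B := (ℓ : ℝ) + 1) (K := K) (M₀ := M₀) (N := N)
      (fun _ => norm_nonneg _)
      (fun m₀ => norm_sum_filter_Icc_le m₀ ℓ _ (norm_char_mul_liouville_le_one χ) S) hM hK hms
  calc _ ≤ (M₀ : ℝ) * ((ℓ : ℝ) + 1) + 2 * Real.sqrt K * N := h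
    _ = ((ℓ : ℝ) + 1) * M₀ + 2 * Real.sqrt K * N := by ring

/-- Window lengths after dividing by `c`: for `r < c`, `⌊(r+j)/c⌋ - 𝟙[r ≠ 0] ≤ j`. [folklore] -/
theorem add_div_sub_ite_le {c r j : ℕ} (hc : 0 < c) (hr : r < c) :
    (r + j) / c - (if r = 0 then 0 else 1) ≤ j := by
  split_ifs with h0
  · subst h0
    rw [zero_add, Nat.sub_zero]
    exact Nat.div_le_self j c
  · have h1 : (r + j) / c ≤ (j + c) / c := Nat.div_le_div_right (by omega)
    rw [Nat.add_div_right j hc] at h1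
    have h2 : j / c ≤ j := Nat.div_le_self j c
    omega

/-- The saving function `κ_t = √((tQ₁ + t²)/V² + t)` is monotone in `t ≥ 0`. [folklore] -/
theorem kappa_mono {Q₁ V s t : ℝ} (hQ₁ : 0 ≤ Q₁) (hs : 0 ≤ s) (hst : s ≤ t) :
    Real.sqrt ((s * Q₁ + s ^ 2) / V ^ 2 + s) ≤ Real.sqrt ((t * Q₁ + t ^ 2) / V ^ 2 + t) := by
  refine Real.sqrt_le_sqrt (add_le_add (div_le_div_of_nonneg_right ?_ (sq_nonneg V)) hst)
  nlinarith [mul_le_mul_of_nonneg_right hst hQ₁]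

open ArithmeticFunction in
/-- **The bound for the twisted window sums `U(j)` at the printed first exponent** (p. 10–11,
(3.11)–(3.13) summed over residues, divisors and characters, with the mean-square input of
`MoebiusShiftedPrimesMeanSquare33.lean` for every window length): for `q ≥ 1`, a set `S`
invariant under the divisors of `q`, `j + 1 ≤ H`, and the discretised mean-square bound
`∑_{Y<k≤2Y} |∑_{k ≤ m ≤ k+h-1, m ∈ S} λχ(m)|² ≤ C(h²Y(Q₁/h+1)/V² + hY)` for the moduli `q/c`,
all `1 ≤ h ≤ H` and the blocks `M₀ ≤ Y ≤ N`:
`∑_{n₀ ≤ N} |∑_{n₀ ≤ m ≤ n₀+j, m ∈ S} λ(m)e(ma/q)| ≤ q((j+2q)M₀ + 2√C κ N)` with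
`κ = √((q(j+2q)Q₁ + (j+2q)²)/V² + q(j+2q))` (the residues `r (mod c)` give windows of lengths
`≤ j/c + 2`, and `c κ_{j/c+2} ≤ κ`). [cite: Lichtman2020, §3.2, (3.11)–(3.13)] -/
theorem sum_twistedWindow_le33 {q N M₀ H j : ℕ} {a : ℤ} {C V Q₁ : ℝ} (S : ℕ → Prop) [DecidablePred S]
    (hq : 0 < q) (hS : ∀ c ∈ q.divisors, ∀ m, S (c * m) ↔ S m) (hV : 0 < V) (hC : 0 ≤ C)
    (hQ₁ : 0 ≤ Q₁) (hM : 1 ≤ M₀) (hjH : j + 1 ≤ H)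
    (h34 : ∀ c ∈ q.divisors, ∀ χ : DirichletCharacter ℂ (q / c), ∀ h : ℕ, 1 ≤ h → h ≤ H →
      ∀ Y : ℕ, M₀ ≤ Y → Y ≤ N →
        ∑ k ∈ Ioc Y (2 * Y), ‖∑ m ∈ (Icc k (k + h - 1)).filter S,
            χ (m : ZMod (q / c)) * ((liouville m : ℤ) : ℂ)‖ ^ 2 ≤
          C * ((h : ℝ) ^ 2 * Y * (Q₁ / h + 1) / V ^ 2 + h * Y)) :
    ∑ n₀ ∈ Icc 1 N, ‖∑ m ∈ (Icc n₀ (n₀ + j)).filter S,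
        ((liouville m : ℤ) : ℂ) * (𝐞 ((m : ℝ) * (a / q)) : ℂ)‖ ≤
      q * (((j : ℝ) + 2 * q) * M₀ + 2 * Real.sqrt C *
        Real.sqrt (((q : ℝ) * (j + 2 * q) * Q₁ + ((j : ℝ) + 2 * q) ^ 2) / V ^ 2 + q * (j + 2 * q)) * N) := by
  have hq1 : (1 : ℝ) ≤ q := by exact_mod_cast hq
  set κ₂ : ℝ := Real.sqrt (((q : ℝ) * (j + 2 * q) * Q₁ + ((j : ℝ) + 2 * q) ^ 2) / V ^ 2 + q * (j + 2 * q))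
    with hκ₂
  have hκ₂0 : 0 ≤ κ₂ := Real.sqrt_nonneg _
  set R : ℝ := ((j : ℝ) + 2 * q) * M₀ + 2 * Real.sqrt C * κ₂ * N with hR
  have hR0 : 0 ≤ R := by positivity
  -- the saving function `κ_t = √((tQ₁ + t²)/V² + t)`
  set κ : ℝ → ℝ := fun t => Real.sqrt ((t * Q₁ + t ^ 2) / V ^ 2 + t) with hκdef
  have hκ0 : ∀ t, 0 ≤ κ t := fun t => Real.sqrt_nonneg _
  -- step 1: residues, gcd, characters (pointwise in `n₀`), then swap the sums
  calc ∑ n₀ ∈ Icc 1 N, ‖∑ m ∈ (Icc n₀ (n₀ + j)).filter S,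
          ((liouville m : ℤ) : ℂ) * (𝐞 ((m : ℝ) * (a / q)) : ℂ)‖
      ≤ ∑ n₀ ∈ Icc 1 N, ∑ c ∈ q.divisors, ∑ χ : DirichletCharacter ℂ (q / c),
          ‖∑ m ∈ (Icc ((n₀ + c - 1) / c) ((n₀ + j) / c)).filter S,
            χ (m : ZMod (q / c)) * ((liouville m : ℤ) : ℂ)‖ :=
        Finset.sum_le_sum fun n₀ _ => norm_twistedWindow_le_sum_divisors hq a S hS _ _
    _ = ∑ c ∈ q.divisors, ∑ χ : DirichletCharacter ℂ (q / c), ∑ n₀ ∈ Icc 1 N,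
          ‖∑ m ∈ (Icc ((n₀ + c - 1) / c) ((n₀ + j) / c)).filter S,
            χ (m : ZMod (q / c)) * ((liouville m : ℤ) : ℂ)‖ := by
        rw [Finset.sum_comm]
        exact Finset.sum_congr rfl fun c _ => Finset.sum_comm
    _ ≤ ∑ c ∈ q.divisors, ∑ _χ : DirichletCharacter ℂ (q / c), R := by
        refine Finset.sum_le_sum fun c hc => Finset.sum_le_sum fun χ _ => ?_
        have hc0 : 0 < c := Nat.pos_of_mem_divisors hc
        have hcq : c ≤ q := Nat.divisor_le hc
        have hc0' : (0 : ℝ) < c := by exact_mod_cast hc0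
        have hcq' : (c : ℝ) ≤ q := by exact_mod_cast hcq
        -- step 2: divided windows → plain windows
        refine (sum_window_cdiv_le hc0 N j (fun s => ‖∑ m ∈ s.filter S,
          χ (m : ZMod (q / c)) * ((liouville m : ℤ) : ℂ)‖) (fun _ => norm_nonneg _)
          (by simp)).trans ?_
        -- the common length bound `t_c = j/c + 2` of the residues
        set t : ℝ := (j : ℝ) / c + 2 with ht
        have ht0 : 0 ≤ t := by positivity
        -- step 3: each residue `r` is a plain-window average of length `ℓ_r + 1 ≤ t_c`
        have hr : ∀ r ∈ range c,
            ∑ m₀ ∈ Icc 1 ((N - 1) / c + 1), ‖∑ m ∈ (Icc m₀ (m₀ + ((r + j) / c -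
              if r = 0 then 0 else 1))).filter S, χ (m : ZMod (q / c)) * ((liouville m : ℤ) : ℂ)‖ ≤
              t * M₀ + 2 * Real.sqrt C * κ t * N := by
          intro r hr
          rw [Finset.mem_range] at hr
          set ℓ : ℕ := (r + j) / c - if r = 0 then 0 else 1 with hℓ
          have hℓj : ℓ ≤ j := add_div_sub_ite_le hc0 hr
          have hℓle : ℓ ≤ (r + j) / c := Nat.sub_le _ _
          have hlen_hi : ℓ + 1 ≤ H := by omega
          have hlen2 : ((ℓ : ℝ) + 1) ≤ t := by
            have e1 : (ℓ : ℝ) ≤ (((r + j) / c : ℕ) : ℝ) := by exact_mod_cast hℓle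
            have e2 : (((r + j) / c : ℕ) : ℝ) ≤ ((r + j : ℕ) : ℝ) / c := Nat.cast_div_le
            have e3 : ((r + j : ℕ) : ℝ) / c ≤ (j : ℝ) / c + 1 := by
              rw [div_add_one hc0'.ne', div_le_div_iff_of_pos_right hc0']
              push_cast
              have : (r : ℝ) ≤ c := by exact_mod_cast hr.le
              linarith
            rw [ht]; linarith
          have hNc : (N - 1) / c + 1 ≤ N ∨ N = 0 := by
            rcases Nat.eq_zero_or_pos N with h | h
            · exact Or.inr h
            · left; have := Nat.div_le_self (N - 1) c; omega
          -- the mean-square constant for this window length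
          set K : ℝ := C * ((((ℓ + 1 : ℕ) : ℝ)) ^ 2 * (Q₁ / ((ℓ + 1 : ℕ) : ℝ) + 1) / V ^ 2 + ((ℓ + 1 : ℕ) : ℝ))
            with hK
          have hK0 : 0 ≤ K := by positivity
          have hKκ : Real.sqrt K ≤ Real.sqrt C * κ t := by
            rw [hκdef]
            simp only
            rw [← Real.sqrt_mul hC]
            refine Real.sqrt_le_sqrt ?_
            rw [hK]
            refine mul_le_mul_of_nonneg_left ?_ hC
            have hl0 : (0 : ℝ) < ((ℓ + 1 : ℕ) : ℝ) := by positivity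
            have e : (((ℓ + 1 : ℕ) : ℝ)) ^ 2 * (Q₁ / ((ℓ + 1 : ℕ) : ℝ) + 1) =
                ((ℓ + 1 : ℕ) : ℝ) * Q₁ + (((ℓ + 1 : ℕ) : ℝ)) ^ 2 := by
              field_simp
            rw [e]
            have hl1 : ((ℓ + 1 : ℕ) : ℝ) ≤ t := by push_cast; exact hlen2
            refine add_le_add (div_le_div_of_nonneg_right ?_ (sq_nonneg V)) hl1
            nlinarith [mul_le_mul_of_nonneg_right hl1 hQ₁]
          rcases hNc with hNc | hN0
          · -- Proposition 3.4 for this character and this window length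
            have hVb := sum_plainWindow_le33 χ S (ℓ := ℓ) (M₀ := M₀) (N := (N - 1) / c + 1) (K := K)
              hM hK0 (fun Y h1 h2 => by
                have h := h34 c hc χ (ℓ + 1) (by omega) hlen_hi Y h1 (h2.trans hNc)
                have hkey : ∀ k : ℕ, k + (ℓ + 1) - 1 = k + ℓ := fun k => by omega
                simp only [hkey] at h
                rw [hK]
                calc _ ≤ _ := h
                  _ = _ := by ring)
            refine hVb.trans ?_
            have hNc' : (((N - 1) / c + 1 : ℕ) : ℝ) ≤ N := by exact_mod_cast hNc
            have e1 : ((ℓ : ℝ) + 1) * M₀ ≤ t * M₀ := mul_le_mul_of_nonneg_right hlen2 (Nat.cast_nonneg _)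
            have e2 : 2 * Real.sqrt K * (((N - 1) / c + 1 : ℕ) : ℝ) ≤ 2 * (Real.sqrt C * κ t) * N :=
              mul_le_mul (mul_le_mul_of_nonneg_left hKκ (by norm_num)) hNc' (Nat.cast_nonneg _)
                (by positivity)
            linarith
          · -- `N = 0`: both sides vanish / are nonnegative
            subst hN0
            have : (0 - 1) / c + 1 = 1 := by simp
            rw [this]
            simp only [Nat.cast_zero, mul_zero, add_zero]
            calc ∑ m₀ ∈ Icc 1 1, ‖∑ m ∈ (Icc m₀ (m₀ + ℓ)).filter S,
                  χ (m : ZMod (q / c)) * ((liouville m : ℤ) : ℂ)‖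
                ≤ ∑ m₀ ∈ Icc 1 1, ((ℓ : ℝ) + 1) := Finset.sum_le_sum fun m₀ _ =>
                    norm_sum_filter_Icc_le m₀ ℓ _ (norm_char_mul_liouville_le_one χ) S
              _ = (ℓ : ℝ) + 1 := by simp
              _ ≤ t * 1 := by linarith
              _ ≤ t * M₀ := mul_le_mul_of_nonneg_left (by exact_mod_cast hM) ht0
        refine (Finset.sum_le_sum hr).trans ?_
        rw [Finset.sum_const, Finset.card_range, nsmul_eq_mul]
        -- `c (t M₀ + 2√C κ_t N) = (j + 2c) M₀ + 2√C (c κ_t) N ≤ R`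
        have hct : (c : ℝ) * t = j + 2 * c := by rw [ht]; field_simp
        have hcκ : (c : ℝ) * κ t ≤ κ₂ := by
          rw [hκdef, hκ₂]
          simp only
          rw [← Real.sqrt_sq hc0'.le, ← Real.sqrt_mul (sq_nonneg _)]
          refine Real.sqrt_le_sqrt ?_
          have hV2 : 0 < V ^ 2 := by positivity
          rw [mul_add, mul_div_assoc', div_add' _ _ _ hV2.ne', div_add' _ _ _ hV2.ne',
            div_le_div_iff_of_pos_right hV2]
          have e1 : (c : ℝ) ^ 2 * (t * Q₁ + t ^ 2) = (c * t) * c * Q₁ + (c * t) ^ 2 := by ring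
          have e2 : (c : ℝ) ^ 2 * t * V ^ 2 = c * (c * t) * V ^ 2 := by ring
          rw [e1, e2, hct]
          have h1 : ((j : ℝ) + 2 * c) ≤ j + 2 * q := by linarith
          have h0 : (0 : ℝ) ≤ j + 2 * c := by positivity
          have h2 : ((j : ℝ) + 2 * c) * c * Q₁ ≤ (q : ℝ) * (j + 2 * q) * Q₁ := by
            have := mul_le_mul h1 hcq' hc0'.le (by positivity)
            calc ((j : ℝ) + 2 * c) * c * Q₁ ≤ ((j : ℝ) + 2 * q) * q * Q₁ :=
                  mul_le_mul_of_nonneg_right this hQ₁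
              _ = (q : ℝ) * (j + 2 * q) * Q₁ := by ring
          have h3 : ((j : ℝ) + 2 * c) ^ 2 ≤ ((j : ℝ) + 2 * q) ^ 2 := pow_le_pow_left₀ h0 h1 2
          have h4 : (c : ℝ) * (j + 2 * c) * V ^ 2 ≤ (q : ℝ) * (j + 2 * q) * V ^ 2 := by
            refine mul_le_mul_of_nonneg_right ?_ (sq_nonneg V)
            exact mul_le_mul hcq' h1 h0 (by positivity)
          linarith
        calc (c : ℝ) * (t * M₀ + 2 * Real.sqrt C * κ t * N)
            = (c * t) * M₀ + 2 * Real.sqrt C * (c * κ t) * N := by ring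
          _ ≤ ((j : ℝ) + 2 * q) * M₀ + 2 * Real.sqrt C * κ₂ * N := by
              rw [hct]
              refine add_le_add ?_ ?_
              · refine mul_le_mul_of_nonneg_right ?_ (Nat.cast_nonneg _); linarith
              · exact mul_le_mul_of_nonneg_right (mul_le_mul_of_nonneg_left hcκ (by positivity))
                  (Nat.cast_nonneg _)
          _ = R := by rw [hR]
    _ = ∑ c ∈ q.divisors, ((q / c).totient : ℝ) * R := by
        refine Finset.sum_congr rfl fun c hc => ?_
        have hc0 : 0 < c := Nat.pos_of_mem_divisors hc
        haveI : NeZero (q / c) :=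
          ⟨(Nat.div_pos (Nat.le_of_dvd hq (Nat.dvd_of_mem_divisors hc)) hc0).ne'⟩
        rw [Finset.sum_const, Finset.card_univ, ← Nat.card_eq_fintype_card,
          DirichletCharacter.card_eq_totient_of_hasEnoughRootsOfUnity ℂ (q / c), nsmul_eq_mul]
    _ = q * R := by rw [← Finset.sum_mul, sum_divisors_totient_div]
    _ = _ := by rw [hR]


/-! ### Numerics of the sub-window variant -/

/-- Power bookkeeping for the major arcs: from `1 ≤ R`, `R³ ≤ W`, `1 ≤ d ≤ W`, `1 ≤ q ≤ W`,
`W^{10} ≤ H`: the monomial inequalities used below. [folklore] -/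
theorem majorArc33_powers {W R d q H : ℝ} (hW : 2 ≤ W) (hR1 : 1 ≤ R) (hR3 : R ^ 3 ≤ W)
    (hdW : d ≤ W) (hqW : q ≤ W) (hH : W ^ 10 ≤ H) :
    R ^ 2 ≤ W ∧ R ≤ W ∧ d * R ≤ W ^ 2 ∧ d * R ^ 2 ≤ W ^ 4 ∧ R * (R ^ 2) ≤ W ∧
      R ^ 3 * W ^ 6 ≤ H ∧ d * R ^ 2 * W ^ 3 ≤ H ∧ 2 * W ^ 2 ≤ H ∧ 2 * W * d ≤ H ∧
      4 * R * W ^ 4 ≤ H ∧ W ^ 5 * q ≤ H := by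
  have hR0 : 0 ≤ R := by linarith
  have hW1 : 1 ≤ W := le_trans (by nlinarith [one_le_pow₀ (n := 3) hR1]) hR3
  have hW0 : 0 ≤ W := by linarith
  have hR2 : R ^ 2 ≤ W := le_trans (by nlinarith) hR3
  have hRW : R ≤ W := le_trans (by nlinarith) hR2
  have hWp : ∀ n : ℕ, 1 ≤ W ^ n := fun n => one_le_pow₀ hW1
  have hWmono : ∀ {m n : ℕ}, m ≤ n → W ^ m ≤ W ^ n := fun h => pow_le_pow_right₀ hW1 h
  have h2pow : ∀ n : ℕ, (2 : ℝ) ^ n ≤ W ^ n := fun n => pow_le_pow_left₀ (by norm_num) hW n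
  have hW8 : (256 : ℝ) ≤ W ^ 8 := by have := h2pow 8; norm_num at this; exact this
  have hW5 : (32 : ℝ) ≤ W ^ 5 := by have := h2pow 5; norm_num at this; exact this
  refine ⟨hR2, hRW, ?_, ?_, ?_, ?_, ?_, ?_, ?_, ?_, ?_⟩
  · calc d * R ≤ W * W := mul_le_mul hdW hRW hR0 hW0
      _ = W ^ 2 := by ring
  · calc d * R ^ 2 ≤ W * W := mul_le_mul hdW hR2 (by positivity) hW0
      _ = W ^ 2 := by ring
      _ ≤ W ^ 4 := hWmono (by norm_num)
  · calc R * R ^ 2 = R ^ 3 := by ring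
      _ ≤ W := hR3
  · calc R ^ 3 * W ^ 6 ≤ W * W ^ 6 := mul_le_mul_of_nonneg_right hR3 (by positivity)
      _ = W ^ 7 := by ring
      _ ≤ W ^ 10 := hWmono (by norm_num)
      _ ≤ H := hH
  · calc d * R ^ 2 * W ^ 3 ≤ W * W * W ^ 3 := by
          refine mul_le_mul (mul_le_mul hdW hR2 (by positivity) hW0) le_rfl (by positivity) (by positivity)
      _ = W ^ 5 := by ring
      _ ≤ W ^ 10 := hWmono (by norm_num)
      _ ≤ H := hH
  · have h2W : (2 : ℝ) ≤ W ^ 8 := by linarith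
    calc 2 * W ^ 2 ≤ W ^ 8 * W ^ 2 := mul_le_mul_of_nonneg_right h2W (by positivity)
      _ = W ^ 10 := by ring
      _ ≤ H := hH
  · calc 2 * W * d ≤ 2 * W * W := mul_le_mul_of_nonneg_left hdW (by positivity)
      _ = 2 * W ^ 2 := by ring
      _ ≤ W ^ 8 * W ^ 2 := by
          refine mul_le_mul_of_nonneg_right ?_ (by positivity)
          linarith
      _ = W ^ 10 := by ring
      _ ≤ H := hH
  · calc 4 * R * W ^ 4 ≤ 4 * W * W ^ 4 := by gcongr
      _ = 4 * W ^ 5 := by ring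
      _ ≤ W ^ 5 * W ^ 5 := by
          rw [mul_comm]
          refine mul_le_mul_of_nonneg_left ?_ (by positivity)
          linarith
      _ = W ^ 10 := by ring
      _ ≤ H := hH
  · calc W ^ 5 * q ≤ W ^ 5 * W := mul_le_mul_of_nonneg_left hqW (by positivity)
      _ = W ^ 6 := by ring
      _ ≤ W ^ 10 := hWmono (by norm_num)
      _ ≤ H := hH

/-- The `M₀` part of the major-arc numerics: `d q M₀ (Φs) ≤ 16 HX/(dR)` when `Φ s ≤ 8H/d`,
`M₀ ≤ 2X/W³`, `q ≤ W`, `dR ≤ W²`. [folklore] -/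
theorem majorArc33_M0_part {W R X H d q M₀r P : ℝ} (hW0 : 0 < W) (hR0 : 0 < R) (hd0 : 0 < d)
    (hq0 : 0 < q) (hqW : q ≤ W) (hH0 : 0 < H) (hX0 : 0 < X) (hdR : d * R ≤ W ^ 2)
    (hM₀0 : 0 ≤ M₀r) (hM₀ : M₀r ≤ 2 * X / W ^ 3) (hP : P ≤ 8 * H / d) :
    d * q * M₀r * P ≤ 16 * (H * X / (d * R)) := by
  have h1 : d * q * M₀r * P ≤ d * q * M₀r * (8 * H / d) := mul_le_mul_of_nonneg_left hP (by positivity)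
  have h2 : d * q * M₀r * (8 * H / d) = 8 * H * (q * M₀r) := by field_simp
  have h3 : q * M₀r ≤ W * (2 * X / W ^ 3) := mul_le_mul hqW hM₀ hM₀0 hW0.le
  have h4 : W * (2 * X / W ^ 3) = 2 * X / W ^ 2 := by field_simp
  have h5 : 2 * X / W ^ 2 ≤ 2 * X / (d * R) := div_le_div_of_nonneg_left (by positivity) (by positivity) hdR
  have h6 : 8 * H * (2 * X / (d * R)) = 16 * (H * X / (d * R)) := by field_simp; ring
  calc d * q * M₀r * P ≤ 8 * H * (q * M₀r) := by rw [← h2]; exact h1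
    _ ≤ 8 * H * (2 * X / (d * R)) := by
        refine mul_le_mul_of_nonneg_left ?_ (by positivity)
        calc q * M₀r ≤ W * (2 * X / W ^ 3) := h3
          _ = 2 * X / W ^ 2 := h4
          _ ≤ 2 * X / (d * R) := h5
    _ = 16 * (H * X / (d * R)) := h6

/-- Term `A₁` of the `κ` part: `2q³(H/W⁴)G₁/V² ≤ 48 (H/(dR))²` for
`G₁ = 16RW⁴H/(d²q) + 8H/d`. [folklore] -/
theorem majorArc33_termA1 {W V R H d q G : ℝ} (hW0 : 0 < W) (hR0 : 0 < R) (hd0 : 0 < d)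
    (hq0 : 0 < q) (hqW : q ≤ W) (hH0 : 0 < H) (hV : W ^ 3 ≤ V ^ 2) (hR3 : R ^ 3 ≤ W)
    (hdR2 : d * R ^ 2 ≤ W ^ 4) (hG0 : 0 ≤ G) (hG : G ≤ 16 * R * W ^ 4 * H / (d ^ 2 * q) + 8 * H / d) :
    2 * q ^ 3 * (H / W ^ 4) * G / V ^ 2 ≤ 48 * (H / (d * R)) ^ 2 := by
  have hW3 : 0 < W ^ 3 := by positivity
  have h1 : 2 * q ^ 3 * (H / W ^ 4) * G / V ^ 2 ≤ 2 * q ^ 3 * (H / W ^ 4) * G / W ^ 3 :=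
    div_le_div_of_nonneg_left (by positivity) hW3 hV
  have h2 : 2 * q ^ 3 * (H / W ^ 4) * G / W ^ 3 ≤
      2 * q ^ 3 * (H / W ^ 4) * (16 * R * W ^ 4 * H / (d ^ 2 * q) + 8 * H / d) / W ^ 3 := by
    refine div_le_div_of_nonneg_right (mul_le_mul_of_nonneg_left hG (by positivity)) hW3.le
  refine h1.trans (h2.trans ?_)
  have e : 2 * q ^ 3 * (H / W ^ 4) * (16 * R * W ^ 4 * H / (d ^ 2 * q) + 8 * H / d) / W ^ 3 =
      (32 * q ^ 2 * R * H ^ 2) / (d ^ 2 * W ^ 3) + (16 * q ^ 3 * H ^ 2) / (d * W ^ 7) := by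
    field_simp; ring
  rw [e]
  have e48 : 48 * (H / (d * R)) ^ 2 = (32 * H ^ 2) / (d ^ 2 * R ^ 2) + (16 * H ^ 2) / (d ^ 2 * R ^ 2) := by
    field_simp; ring
  rw [e48]
  refine add_le_add ?_ ?_
  · -- `q² R/W³ ≤ 1/R²` as `q² R³ ≤ W³`
    rw [div_le_div_iff₀ (by positivity) (by positivity)]
    have h3 : q ^ 2 * R * R ^ 2 ≤ W ^ 3 := by
      calc q ^ 2 * R * R ^ 2 = q ^ 2 * R ^ 3 := by ring
        _ ≤ W ^ 2 * W := mul_le_mul (pow_le_pow_left₀ hq0.le hqW 2) hR3 (by positivity) (by positivity)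
        _ = W ^ 3 := by ring
    have h4 : 0 ≤ 32 * H ^ 2 * d ^ 2 := by positivity
    nlinarith [mul_le_mul_of_nonneg_left h3 h4]
  · rw [div_le_div_iff₀ (by positivity) (by positivity)]
    have h3 : q ^ 3 * (d * R ^ 2) ≤ W ^ 7 := by
      calc q ^ 3 * (d * R ^ 2) ≤ W ^ 3 * W ^ 4 :=
            mul_le_mul (pow_le_pow_left₀ hq0.le hqW 3) hdR2 (by positivity) (by positivity)
        _ = W ^ 7 := by ring
    have h4 : 0 ≤ 16 * H ^ 2 * d := by positivity
    nlinarith [mul_le_mul_of_nonneg_left h3 h4]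

/-- Term `A₂` of the `κ` part: `4q²G₂/V² ≤ 64 (H/(dR))²` for `G₂ = 16H²/d²`. [folklore] -/
theorem majorArc33_termA2 {W V R H d q G : ℝ} (hW0 : 0 < W) (hR0 : 0 < R) (hd0 : 0 < d)
    (hq0 : 0 < q) (hqW : q ≤ W) (hH0 : 0 < H) (hV : W ^ 3 ≤ V ^ 2) (hR2 : R ^ 2 ≤ W)
    (hG0 : 0 ≤ G) (hG : G ≤ 16 * H ^ 2 / d ^ 2) :
    4 * q ^ 2 * G / V ^ 2 ≤ 64 * (H / (d * R)) ^ 2 := by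
  have hW3 : 0 < W ^ 3 := by positivity
  have h1 : 4 * q ^ 2 * G / V ^ 2 ≤ 4 * q ^ 2 * G / W ^ 3 :=
    div_le_div_of_nonneg_left (by positivity) hW3 hV
  have h2 : 4 * q ^ 2 * G / W ^ 3 ≤ 4 * q ^ 2 * (16 * H ^ 2 / d ^ 2) / W ^ 3 :=
    div_le_div_of_nonneg_right (mul_le_mul_of_nonneg_left hG (by positivity)) hW3.le
  refine h1.trans (h2.trans ?_)
  have e : 4 * q ^ 2 * (16 * H ^ 2 / d ^ 2) / W ^ 3 = (64 * q ^ 2 * H ^ 2) / (d ^ 2 * W ^ 3) := by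
    field_simp; ring
  have e2 : 64 * (H / (d * R)) ^ 2 = (64 * H ^ 2) / (d ^ 2 * R ^ 2) := by field_simp
  rw [e, e2, div_le_div_iff₀ (by positivity) (by positivity)]
  have h3 : q ^ 2 * R ^ 2 ≤ W ^ 3 := by
    calc q ^ 2 * R ^ 2 ≤ W ^ 2 * W := mul_le_mul (pow_le_pow_left₀ hq0.le hqW 2) hR2 (by positivity) (by positivity)
      _ = W ^ 3 := by ring
  have h4 : 0 ≤ 64 * H ^ 2 * d ^ 2 := by positivity
  nlinarith [mul_le_mul_of_nonneg_left h3 h4]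

/-- Term `A₃` of the `κ` part: `2q³G₁ ≤ 48 (H/(dR))²` for `G₁ = 16RW⁴H/(d²q) + 8H/d`, using
`R³W⁶ ≤ H` and `dR²W³ ≤ H`. [folklore] -/
theorem majorArc33_termA3 {W R H d q G : ℝ} (hW0 : 0 < W) (hR0 : 0 < R) (hd0 : 0 < d)
    (hq0 : 0 < q) (hqW : q ≤ W) (hH0 : 0 < H) (hR3W6 : R ^ 3 * W ^ 6 ≤ H)
    (hdR2W3 : d * R ^ 2 * W ^ 3 ≤ H) (hG : G ≤ 16 * R * W ^ 4 * H / (d ^ 2 * q) + 8 * H / d) :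
    2 * q ^ 3 * G ≤ 48 * (H / (d * R)) ^ 2 := by
  have h1 : 2 * q ^ 3 * G ≤ 2 * q ^ 3 * (16 * R * W ^ 4 * H / (d ^ 2 * q) + 8 * H / d) :=
    mul_le_mul_of_nonneg_left hG (by positivity)
  refine h1.trans ?_
  have e : 2 * q ^ 3 * (16 * R * W ^ 4 * H / (d ^ 2 * q) + 8 * H / d) =
      (32 * q ^ 2 * R * W ^ 4 * H) / d ^ 2 + (16 * q ^ 3 * H) / d := by
    field_simp; ring
  have e48 : 48 * (H / (d * R)) ^ 2 = (32 * H ^ 2) / (d ^ 2 * R ^ 2) + (16 * H ^ 2) / (d ^ 2 * R ^ 2) := by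
    field_simp; ring
  rw [e, e48]
  refine add_le_add ?_ ?_
  · rw [div_le_div_iff₀ (by positivity) (by positivity)]
    have h3 : q ^ 2 * R * W ^ 4 * R ^ 2 ≤ H := by
      calc q ^ 2 * R * W ^ 4 * R ^ 2 = R ^ 3 * (q ^ 2 * W ^ 4) := by ring
        _ ≤ R ^ 3 * (W ^ 2 * W ^ 4) := by
            refine mul_le_mul_of_nonneg_left ?_ (by positivity)
            exact mul_le_mul_of_nonneg_right (pow_le_pow_left₀ hq0.le hqW 2) (by positivity)
        _ = R ^ 3 * W ^ 6 := by ring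
        _ ≤ H := hR3W6
    have h4 : 0 ≤ 32 * H * d ^ 2 := by positivity
    nlinarith [mul_le_mul_of_nonneg_left h3 h4]
  · rw [div_le_div_iff₀ hd0 (by positivity)]
    have h3 : q ^ 3 * (d * R ^ 2) ≤ H := by
      calc q ^ 3 * (d * R ^ 2) ≤ W ^ 3 * (d * R ^ 2) :=
            mul_le_mul_of_nonneg_right (pow_le_pow_left₀ hq0.le hqW 3) (by positivity)
        _ = d * R ^ 2 * W ^ 3 := by ring
        _ ≤ H := hdR2W3
    have h4 : 0 ≤ 16 * H * d := by positivity
    nlinarith [mul_le_mul_of_nonneg_left h3 h4]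

set_option maxHeartbeats 800000 in
/-- **Numerics of the major arcs at the printed first exponent** (both cases of the sub-window
argument): with `T = HX/(dR)`, a main-term coefficient `Φ'` (`= 2L/h + 2`, resp. `2`) with
`Φ'h ≤ 4H/d`, `Φ' ≤ 4RW⁴/(dq) + 2`, an error coefficient `Φ''` with `Φ''h·(h|θ|) ≤ 4H/(dR)`, and
`2q ≤ h`, the bound `dΦ'·q((h-1+2q)M₀ + 2√C κ N₂) + XΦ''h·2πh|θ| ≤ (16 + 8π + 52√C) T`, where
`κ² ≤ (q(h-1+2q)Q₁ + (h-1+2q)²)/V² + q(h-1+2q)`, `Q₁ = H/W⁴`, `M₀ ≤ 2X/W³`, `N₂ ≤ 2X/d`.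
[cite: Lichtman2020, §3.2 (numerics of the sub-window variant)] -/
theorem majorArc33_numerics {W V R C X H d q hh M₀r N₂r θa κ Φ' Φ'' : ℝ}
    (hW : 2 ≤ W) (hR1 : 1 ≤ R) (hR3 : R ^ 3 ≤ W) (hV0 : 0 < V) (hV : W ^ 3 ≤ V ^ 2)
    (hd1 : 1 ≤ d) (hdW : d ≤ W) (hq1 : 1 ≤ q) (hqW : q ≤ W) (hH : W ^ 10 ≤ H) (hHX : 2 * H ≤ X)
    (hh1 : 1 ≤ hh) (h2q : 2 * q ≤ hh)
    (hΦ'0 : 0 ≤ Φ') (hΦ'h : Φ' * hh ≤ 4 * H / d) (hΦ'le : Φ' ≤ 4 * R * W ^ 4 / (d * q) + 2)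
    (herr : Φ'' * hh * (hh * θa) ≤ 4 * H / (d * R))
    (hM₀0 : 0 ≤ M₀r) (hM₀ : M₀r ≤ 2 * X / W ^ 3) (hN₂ : N₂r ≤ 2 * X / d)
    (hκ0 : 0 ≤ κ)
    (hκ : κ ^ 2 ≤ (q * (hh - 1 + 2 * q) * (H / W ^ 4) + (hh - 1 + 2 * q) ^ 2) / V ^ 2 +
      q * (hh - 1 + 2 * q)) :
    d * Φ' * (q * ((hh - 1 + 2 * q) * M₀r + 2 * Real.sqrt C * κ * N₂r))
      + X * Φ'' * (hh * (2 * Real.pi * hh * θa)) ≤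
      (16 + 8 * Real.pi + 52 * Real.sqrt C) * (H * X / (d * R)) := by
  obtain ⟨hR2, hRW, hdR, hdR2, -, hR3W6, hdR2W3, -, -, -, -⟩ :=
    majorArc33_powers hW hR1 hR3 hdW hqW hH
  -- positivity
  have hW0 : 0 < W := by linarith
  have hR0 : 0 < R := by linarith
  have hd0 : 0 < d := by linarith
  have hq0 : 0 < q := by linarith
  have hH0 : 0 < H := lt_of_lt_of_le (by positivity) hH
  have hX0 : 0 < X := by linarith
  have hh0 : 0 < hh := by linarith
  have hV2 : 0 < V ^ 2 := by positivity
  have hW4 : 0 < W ^ 4 := by positivity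
  set T : ℝ := H * X / (d * R) with hT
  have hT0 : 0 ≤ T := by positivity
  set s : ℝ := hh - 1 + 2 * q with hs
  have hs0 : 0 ≤ s := by rw [hs]; linarith
  have hs2 : s ≤ 2 * hh := by rw [hs]; linarith
  have hΦh0 : 0 ≤ Φ' * hh := by positivity
  -- (i) the `M₀` part
  have hΦs : Φ' * s ≤ 8 * H / d := by
    have h1 : Φ' * s ≤ Φ' * (2 * hh) := mul_le_mul_of_nonneg_left hs2 hΦ'0
    have h2 : Φ' * (2 * hh) = 2 * (Φ' * hh) := by ring
    have h3 : 2 * (Φ' * hh) ≤ 2 * (4 * H / d) := by linarith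
    have h4 : 2 * (4 * H / d) = 8 * H / d := by ring
    linarith
  have hpart1 : d * Φ' * (q * (s * M₀r)) ≤ 16 * T := by
    have e : d * Φ' * (q * (s * M₀r)) = d * q * M₀r * (Φ' * s) := by ring
    rw [e, hT]
    exact majorArc33_M0_part hW0 hR0 hd0 hq0 hqW hH0 hX0 hdR hM₀0 hM₀ hΦs
  -- (ii) the `κ` part: `(q Φ' κ)² ≤ 169 (H/(dR))²`
  have hκ' : κ ^ 2 ≤ (2 * q * hh * (H / W ^ 4) + 4 * hh ^ 2) / V ^ 2 + 2 * q * hh := by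
    refine hκ.trans (add_le_add (div_le_div_of_nonneg_right ?_ hV2.le) ?_)
    · have e1 : q * s * (H / W ^ 4) ≤ q * (2 * hh) * (H / W ^ 4) :=
        mul_le_mul_of_nonneg_right (mul_le_mul_of_nonneg_left hs2 hq0.le) (by positivity)
      have e2 : s ^ 2 ≤ (2 * hh) ^ 2 := pow_le_pow_left₀ hs0 hs2 2
      have e3 : (2 * hh) ^ 2 = 4 * hh ^ 2 := by ring
      have e4 : q * (2 * hh) * (H / W ^ 4) = 2 * q * hh * (H / W ^ 4) := by ring
      linarith
    · have : q * s ≤ q * (2 * hh) := mul_le_mul_of_nonneg_left hs2 hq0.le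
      linarith
  have hG₁ : Φ' * (Φ' * hh) ≤ 16 * R * W ^ 4 * H / (d ^ 2 * q) + 8 * H / d := by
    calc Φ' * (Φ' * hh) ≤ (4 * R * W ^ 4 / (d * q) + 2) * (4 * H / d) :=
          mul_le_mul hΦ'le hΦ'h hΦh0 (by positivity)
      _ = 16 * R * W ^ 4 * H / (d ^ 2 * q) + 8 * H / d := by field_simp; ring
  have hG₂ : (Φ' * hh) ^ 2 ≤ 16 * H ^ 2 / d ^ 2 := by
    calc (Φ' * hh) ^ 2 ≤ (4 * H / d) ^ 2 := pow_le_pow_left₀ hΦh0 hΦ'h 2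
      _ = 16 * H ^ 2 / d ^ 2 := by field_simp; norm_num
  have hG₁0 : 0 ≤ Φ' * (Φ' * hh) := by positivity
  have hA1 := majorArc33_termA1 hW0 hR0 hd0 hq0 hqW hH0 hV hR3 hdR2 hG₁0 hG₁
  have hA2 := majorArc33_termA2 hW0 hR0 hd0 hq0 hqW hH0 hV hR2 (sq_nonneg _) hG₂
  have hA3 := majorArc33_termA3 hW0 hR0 hd0 hq0 hqW hH0 hR3W6 hdR2W3 hG₁
  have hPsq : (q * Φ' * κ) ^ 2 ≤ (13 * (H / (d * R))) ^ 2 := by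
    have e : (q * Φ' * κ) ^ 2 = q ^ 2 * Φ' ^ 2 * κ ^ 2 := by ring
    rw [e]
    have h1 : q ^ 2 * Φ' ^ 2 * κ ^ 2 ≤
        q ^ 2 * Φ' ^ 2 * ((2 * q * hh * (H / W ^ 4) + 4 * hh ^ 2) / V ^ 2 + 2 * q * hh) :=
      mul_le_mul_of_nonneg_left hκ' (by positivity)
    refine h1.trans ?_
    have e2 : q ^ 2 * Φ' ^ 2 * ((2 * q * hh * (H / W ^ 4) + 4 * hh ^ 2) / V ^ 2 + 2 * q * hh) =
        2 * q ^ 3 * (H / W ^ 4) * (Φ' * (Φ' * hh)) / V ^ 2 + 4 * q ^ 2 * (Φ' * hh) ^ 2 / V ^ 2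
          + 2 * q ^ 3 * (Φ' * (Φ' * hh)) := by
      field_simp
    rw [e2]
    have e3 : (13 * (H / (d * R))) ^ 2 = 169 * (H / (d * R)) ^ 2 := by ring
    rw [e3]
    nlinarith [hA1, hA2, hA3, sq_nonneg (H / (d * R))]
  have hP : q * Φ' * κ ≤ 13 * (H / (d * R)) := le_of_sq_le_sq hPsq (by positivity)
  have hpart2 : d * Φ' * (q * (2 * Real.sqrt C * κ * N₂r)) ≤ 52 * Real.sqrt C * T := by
    have hdN : d * N₂r ≤ 2 * X := by
      calc d * N₂r ≤ d * (2 * X / d) := mul_le_mul_of_nonneg_left hN₂ hd0.le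
        _ = 2 * X := by field_simp
    calc d * Φ' * (q * (2 * Real.sqrt C * κ * N₂r)) = 2 * Real.sqrt C * (d * N₂r) * (q * Φ' * κ) := by ring
      _ ≤ 2 * Real.sqrt C * (2 * X) * (13 * (H / (d * R))) :=
          mul_le_mul (mul_le_mul_of_nonneg_left hdN (by positivity)) hP (by positivity) (by positivity)
      _ = 52 * Real.sqrt C * T := by rw [hT]; ring
  -- (iii) the phase error
  have hpart3 : X * Φ'' * (hh * (2 * Real.pi * hh * θa)) ≤ 8 * Real.pi * T := by
    have e : X * Φ'' * (hh * (2 * Real.pi * hh * θa)) = 2 * Real.pi * X * (Φ'' * hh * (hh * θa)) := by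
      ring
    rw [e]
    calc 2 * Real.pi * X * (Φ'' * hh * (hh * θa)) ≤ 2 * Real.pi * X * (4 * H / (d * R)) :=
          mul_le_mul_of_nonneg_left herr (by positivity)
      _ = 8 * Real.pi * T := by rw [hT]; field_simp; ring
  -- assemble
  have e : d * Φ' * (q * ((hh - 1 + 2 * q) * M₀r + 2 * Real.sqrt C * κ * N₂r)) =
      d * Φ' * (q * (s * M₀r)) + d * Φ' * (q * (2 * Real.sqrt C * κ * N₂r)) := by
    rw [hs]; ring
  rw [e]
  have : (16 + 8 * Real.pi + 52 * Real.sqrt C) * T = 16 * T + 8 * Real.pi * T + 52 * Real.sqrt C * T := by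
    ring
  rw [this]
  linarith

/-- The coefficients of case `|θ|H > d/R` (sub-windows `h = ⌊1/(R|θ|)⌋`, so `h|θ| ≤ 1/R`,
`h ≥ qH/(2RW⁴)`, `h ≤ H/d`): `(2L/h+2)h ≤ 4H/d`, `2L/h+2 ≤ 4RW⁴/(dq)+2`,
`(L/h+1)h(h|θ|) ≤ 4H/(dR)` and `2q ≤ h`. [folklore] -/
theorem majorArc33_coeffsB {W R H d q ℓr hh θa : ℝ} (hW : 2 ≤ W) (hR1 : 1 ≤ R) (hR3 : R ^ 3 ≤ W)
    (hd1 : 1 ≤ d) (hdW : d ≤ W) (hq1 : 1 ≤ q) (hqW : q ≤ W) (hH : W ^ 10 ≤ H)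
    (hℓ0 : 0 ≤ ℓr) (hℓ : ℓr ≤ H / d) (hh1 : 1 ≤ hh) (hhH : hh ≤ H / d)
    (hθ0 : 0 ≤ θa) (hhθ : hh * θa ≤ 1 / R) (hhlo : q * H / (2 * R * W ^ 4) ≤ hh) :
    (2 * ℓr / hh + 2) * hh ≤ 4 * H / d ∧ 2 * ℓr / hh + 2 ≤ 4 * R * W ^ 4 / (d * q) + 2 ∧
      (ℓr / hh + 1) * hh * (hh * θa) ≤ 4 * H / (d * R) ∧ 2 * q ≤ hh := by
  obtain ⟨-, -, -, -, -, -, -, -, -, h4RW4, -⟩ := majorArc33_powers hW hR1 hR3 hdW hqW hH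
  have hW0 : 0 < W := by linarith
  have hR0 : 0 < R := by linarith
  have hd0 : 0 < d := by linarith
  have hq0 : 0 < q := by linarith
  have hH0 : 0 < H := lt_of_lt_of_le (by positivity) hH
  have hh0 : 0 < hh := by linarith
  refine ⟨?_, ?_, ?_, ?_⟩
  · have e : (2 * ℓr / hh + 2) * hh = 2 * ℓr + 2 * hh := by field_simp
    rw [e]
    have e2 : 4 * H / d = 2 * (H / d) + 2 * (H / d) := by ring
    rw [e2]
    exact add_le_add (by linarith) (by linarith)
  · have hinv : 1 / hh ≤ 2 * R * W ^ 4 / (q * H) := by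
      rw [div_le_div_iff₀ hh0 (by positivity), one_mul]
      have e : q * H = q * H / (2 * R * W ^ 4) * (2 * R * W ^ 4) := by field_simp
      rw [e]
      calc q * H / (2 * R * W ^ 4) * (2 * R * W ^ 4) ≤ hh * (2 * R * W ^ 4) :=
            mul_le_mul_of_nonneg_right hhlo (by positivity)
        _ = 2 * R * W ^ 4 * hh := by ring
    have h1 : 2 * ℓr / hh = 2 * ℓr * (1 / hh) := by ring
    have h2 : 2 * ℓr * (1 / hh) ≤ 2 * (H / d) * (2 * R * W ^ 4 / (q * H)) :=
      mul_le_mul (by linarith) hinv (by positivity) (by positivity)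
    have h3 : 2 * (H / d) * (2 * R * W ^ 4 / (q * H)) = 4 * R * W ^ 4 / (d * q) := by
      field_simp; ring
    have h4 : 2 * ℓr / hh ≤ 4 * R * W ^ 4 / (d * q) := by rw [h1, ← h3]; exact h2
    linarith
  · have e : (ℓr / hh + 1) * hh * (hh * θa) = (ℓr + hh) * (hh * θa) := by field_simp
    rw [e]
    calc (ℓr + hh) * (hh * θa) ≤ (2 * (H / d)) * (1 / R) :=
          mul_le_mul (by linarith) hhθ (by positivity) (by positivity)
      _ = 2 * H / (d * R) := by field_simp
      _ ≤ 4 * H / (d * R) := by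
          refine div_le_div_of_nonneg_right ?_ (by positivity); linarith
  · refine le_trans ?_ hhlo
    rw [le_div_iff₀ (by positivity)]
    calc 2 * q * (2 * R * W ^ 4) = q * (4 * R * W ^ 4) := by ring
      _ ≤ q * H := mul_le_mul_of_nonneg_left h4RW4 hq0.le

/-- The coefficients of case `|θ|H ≤ d/R` (a single piece `h = L + 1 ≤ 2H/d`): `2h ≤ 4H/d`,
`2 ≤ 4RW⁴/(dq) + 2`, `h(h|θ|) ≤ 4H/(dR)` and `2q ≤ h`. [folklore] -/
theorem majorArc33_coeffsA {W R H d q ℓr hh θa : ℝ} (hW : 2 ≤ W) (hR1 : 1 ≤ R) (hR3 : R ^ 3 ≤ W)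
    (hd1 : 1 ≤ d) (hdW : d ≤ W) (hq1 : 1 ≤ q) (hqW : q ≤ W) (hH : W ^ 10 ≤ H)
    (hℓ : ℓr ≤ H / d) (hℓlo : H / d - 2 ≤ ℓr) (hhℓ : hh = ℓr + 1)
    (hθ0 : 0 ≤ θa) (hθ : θa * H ≤ d / R) :
    2 * hh ≤ 4 * H / d ∧ (2 : ℝ) ≤ 4 * R * W ^ 4 / (d * q) + 2 ∧
      1 * hh * (hh * θa) ≤ 4 * H / (d * R) ∧ 2 * q ≤ hh := by
  obtain ⟨-, -, -, -, -, -, -, -, -, -, hW5q⟩ := majorArc33_powers hW hR1 hR3 hdW hqW hH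
  have hW0 : 0 < W := by linarith
  have hR0 : 0 < R := by linarith
  have hd0 : 0 < d := by linarith
  have hq0 : 0 < q := by linarith
  have hH0 : 0 < H := lt_of_lt_of_le (by positivity) hH
  -- `1 ≤ H/d` (indeed `W⁹ ≤ H/d`)
  have hHd : W ^ 9 ≤ H / d := by
    rw [le_div_iff₀ hd0]
    calc W ^ 9 * d ≤ W ^ 9 * W := mul_le_mul_of_nonneg_left hdW (by positivity)
      _ = W ^ 10 := by ring
      _ ≤ H := hH
  have hW9 : (4 : ℝ) ≤ W ^ 9 := by
    have := pow_le_pow_left₀ (by norm_num : (0 : ℝ) ≤ 2) hW 9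
    linarith [show (2 : ℝ) ^ 9 = 512 by norm_num]
  have hHd1 : 1 ≤ H / d := by linarith
  have hh2 : hh ≤ 2 * (H / d) := by rw [hhℓ]; linarith
  have hh0 : 0 ≤ hh := by
    rw [hhℓ]
    linarith
  refine ⟨?_, ?_, ?_, ?_⟩
  · have : 4 * H / d = 2 * (2 * (H / d)) := by ring
    rw [this]; linarith
  · have : 0 ≤ 4 * R * W ^ 4 / (d * q) := by positivity
    linarith
  · rw [one_mul]
    have h1 : hh * θa ≤ 2 * (H / d) * θa := mul_le_mul_of_nonneg_right hh2 hθ0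
    have h2 : 2 * (H / d) * θa = 2 * (θa * H) / d := by ring
    have h3 : 2 * (θa * H) / d ≤ 2 * (d / R) / d :=
      div_le_div_of_nonneg_right (by linarith) hd0.le
    have h4 : 2 * (d / R) / d = 2 / R := by field_simp
    have h5 : hh * θa ≤ 2 / R := by linarith
    calc hh * (hh * θa) ≤ (2 * (H / d)) * (2 / R) := mul_le_mul hh2 h5 (by positivity) (by positivity)
      _ = 4 * H / (d * R) := by field_simp; ring
  · -- `2q ≤ 2W ≤ W⁹/... ≤ H/d - 1 ≤ hh`
    have h1 : 2 * q ≤ H / d - 1 := by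
      have h2 : W ^ 5 * q / d ≤ H / d := div_le_div_of_nonneg_right hW5q hd0.le
      have h3 : 2 * q + 1 ≤ W ^ 5 * q / d := by
        rw [le_div_iff₀ hd0]
        -- `(2q+1) d ≤ 3q W ≤ W⁵ q`
        have h4 : (2 * q + 1) * d ≤ 3 * q * W := by nlinarith
        have h5 : 3 * q * W ≤ W ^ 5 * q := by
          have h6 : (3 : ℝ) * W ≤ W ^ 5 := by
            have := pow_le_pow_left₀ (by norm_num : (0 : ℝ) ≤ 2) hW 4
            have h7 : (16 : ℝ) ≤ W ^ 4 := by linarith [show (2 : ℝ) ^ 4 = 16 by norm_num]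
            nlinarith
          nlinarith
        linarith
      linarith
    rw [hhℓ]; linarith


/-! ### The major arc bound at a fixed scale -/

/-- The saving function of `sum_twistedWindow_le33`, `κ(t) = √((qtQ₁ + t²)/V² + qt)`, is monotone
in `t ≥ 0`. [folklore] -/
theorem kappa2_mono {q Q₁ V s t : ℝ} (hq : 0 ≤ q) (hQ₁ : 0 ≤ Q₁) (hs : 0 ≤ s) (hst : s ≤ t) :
    Real.sqrt ((q * s * Q₁ + s ^ 2) / V ^ 2 + q * s) ≤ Real.sqrt ((q * t * Q₁ + t ^ 2) / V ^ 2 + q * t) := by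
  refine Real.sqrt_le_sqrt (add_le_add (div_le_div_of_nonneg_right ?_ (sq_nonneg V))
    (mul_le_mul_of_nonneg_left hst hq))
  have h1 : q * s * Q₁ ≤ q * t * Q₁ :=
    mul_le_mul_of_nonneg_right (mul_le_mul_of_nonneg_left hst hq) hQ₁
  nlinarith

set_option maxHeartbeats 1600000 in
open ArithmeticFunction in
/-- **Lichtman's major arcs at a fixed `X`, by sub-windows** (replacing the Abel summation (3.9) of
pp. 10–11): for `α = a/q + θ`, `q ≤ W`, `|θ| ≤ W⁴/(qH)`, `d ≤ W`, a set `S` invariant under the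
divisors of `q`, and the mean-square bound of Proposition 3.4 (discretised, every window length
`1 ≤ h ≤ H`, blocks `X/W⁶ ≤ Y ≤ 2X`, saving `1/V²` with `V² ≥ W³`) for the moduli `q/c`, `c ∣ q`:
`∑_{k ≤ X} |∑_{k ≤ md ≤ k+H-1, m ∈ S} λ(m) e(mα)| ≤ (16 + 8π + 52√C) HX/(dR)` for any `R ≥ 1` with
`R³ ≤ W` (in the application `R = W^{1/5}`).  Each window `{m : k ≤ md ≤ k+H-1}` (of `n + 1`
integers, `n ∈ {L-1, L}`, `L = ⌊(H-1)/d⌋`) is cut into pieces of `h` integers on which `e(mθ)` is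
constant up to `2πh|θ|` (`norm_sum_window_le_pieces`); `h = L + 1` if `|θ|H ≤ d/R`, else
`h = ⌊1/(R|θ|)⌋ ≥ qH/(2RW⁴)`; the pieces are summed over `k` (factor `d` from `k ↦ ⌈k/d⌉`, shifts by
`jh ≤ L`) and bounded by `sum_twistedWindow_le33` (residues, characters, dyadic Cauchy–Schwarz with
the mean-square input at lengths `≤ h`); the numerics are `majorArc33_numerics`.
[cite: Lichtman2020, Proposition 3.2 (proof), pp. 10–11] -/
theorem majorArc_fixed_bound33 {X H d q : ℕ} {a : ℤ} {θ W V R C : ℝ} (S : ℕ → Prop) [DecidablePred S]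
    (hX : 1 ≤ X) (hd : 1 ≤ d) (hdW : (d : ℝ) ≤ W) (hq : 1 ≤ q) (hqW : (q : ℝ) ≤ W) (hW : 2 ≤ W)
    (hR1 : 1 ≤ R) (hR3 : R ^ 3 ≤ W) (hV0 : 0 < V) (hV : W ^ 3 ≤ V ^ 2)
    (hHW : W ^ 10 ≤ H) (hHX : 2 * (H : ℝ) ≤ X) (hθ : |θ| ≤ W ^ 4 / (q * H)) (hC : 0 ≤ C)
    (hS : ∀ c ∈ q.divisors, ∀ m, S (c * m) ↔ S m)
    (h34 : ∀ c ∈ q.divisors, ∀ χ : DirichletCharacter ℂ (q / c), ∀ h : ℕ, 1 ≤ h → h ≤ H →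
      ∀ Y : ℕ, (X : ℝ) / W ^ 6 ≤ Y → Y ≤ 2 * X →
        ∑ k ∈ Ioc Y (2 * Y), ‖∑ m ∈ (Icc k (k + h - 1)).filter S,
            χ (m : ZMod (q / c)) * ((liouville m : ℤ) : ℂ)‖ ^ 2 ≤
          C * ((h : ℝ) ^ 2 * Y * ((H : ℝ) / W ^ 4 / h + 1) / V ^ 2 + h * Y)) :
    ∑ k ∈ Icc 1 X, ‖∑ m ∈ (windowDiv d H k).filter S,
        ((liouville m : ℤ) : ℂ) * (𝐞 ((m : ℝ) * (a / q + θ)) : ℂ)‖ ≤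
      (16 + 8 * Real.pi + 52 * Real.sqrt C) * ((H : ℝ) * X / (d * R)) := by
  -- sizes
  have hW0 : (0 : ℝ) < W := by linarith
  have hW1 : (1 : ℝ) ≤ W := by linarith
  have hd0 : 0 < d := hd
  have hq0 : 0 < q := hq
  have hd1 : (1 : ℝ) ≤ d := by exact_mod_cast hd
  have hq1 : (1 : ℝ) ≤ q := by exact_mod_cast hq
  have hd0r : (0 : ℝ) < d := by linarith
  have hq0r : (0 : ℝ) < q := by linarith
  have hR0 : 0 < R := by linarith
  have hX0 : (0 : ℝ) ≤ X := Nat.cast_nonneg X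
  have hWpow : ∀ n : ℕ, (2 : ℝ) ^ n ≤ W ^ n := fun n => pow_le_pow_left₀ (by norm_num) hW n
  have hW10 : (1024 : ℝ) ≤ W ^ 10 := by have := hWpow 10; norm_num at this; exact this
  have hHr : (1024 : ℝ) ≤ H := hW10.trans hHW
  have hH0r : (0 : ℝ) < H := by linarith
  have hWH : W ≤ (H : ℝ) := by
    calc W = W ^ 1 := (pow_one W).symm
      _ ≤ W ^ 10 := pow_le_pow_right₀ hW1 (by norm_num)
      _ ≤ H := hHW
  have hdH : d + 1 ≤ H := by
    have h1 : (d : ℝ) + 1 ≤ H := by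
      have : (d : ℝ) ≤ W := hdW
      have h2 : 2 * W ≤ (H : ℝ) := by
        calc 2 * W ≤ W * W := by nlinarith
          _ = W ^ 2 := by ring
          _ ≤ W ^ 10 := pow_le_pow_right₀ hW1 (by norm_num)
          _ ≤ H := hHW
      linarith
    exact_mod_cast h1
  have hH1 : 1 ≤ H := by omega
  have hXr1 : (1 : ℝ) ≤ X := by exact_mod_cast hX
  -- the coefficient `f = λ e(·a/q) 𝟙_S` and the window sums
  obtain ⟨f, hf⟩ : ∃ f : ℕ → ℂ, ∀ m, f m = if S m then
      ((liouville m : ℤ) : ℂ) * (𝐞 ((m : ℝ) * (a / q)) : ℂ) else 0 := ⟨_, fun _ => rfl⟩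
  have hg1 : ∀ m : ℕ, ‖((liouville m : ℤ) : ℂ) * (𝐞 ((m : ℝ) * (a / q)) : ℂ)‖ ≤ 1 := by
    intro m
    rw [norm_mul, norm_fourierChar, mul_one]
    exact norm_liouville_le_one m
  have hf1 : ∀ m, ‖f m‖ ≤ 1 := by
    intro m; rw [hf]; split_ifs
    · exact hg1 m
    · simp
  have hrew : ∀ s : Finset ℕ, ∑ m ∈ s.filter S,
      ((liouville m : ℤ) : ℂ) * (𝐞 ((m : ℝ) * (a / q + θ)) : ℂ) =
        ∑ m ∈ s, f m * (𝐞 ((m : ℝ) * θ) : ℂ) := by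
    intro s
    rw [Finset.sum_filter]
    refine Finset.sum_congr rfl fun m _ => ?_
    rw [hf]
    split_ifs
    · rw [mul_add, AddChar.map_add_eq_mul, Circle.coe_mul]; ring
    · rw [zero_mul]
  have hPf : ∀ v ℓ, ‖∑ m ∈ Icc v (v + ℓ), f m‖ = ‖∑ m ∈ (Icc v (v + ℓ)).filter S,
      ((liouville m : ℤ) : ℂ) * (𝐞 ((m : ℝ) * (a / q)) : ℂ)‖ := by
    intro v ℓ
    rw [Finset.sum_filter]
    simp only [hf]
  -- `L`, `N`, `M₀`, `N₂`
  obtain ⟨L, hLdef⟩ : ∃ L : ℕ, L = (H - 1) / d := ⟨_, rfl⟩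
  have hL1 : 1 ≤ L := by
    rw [hLdef]; exact (Nat.le_div_iff_mul_le hd0).mpr (by omega)
  have hLreal : (L : ℝ) ≤ H / d := by
    rw [hLdef]
    calc (((H - 1) / d : ℕ) : ℝ) ≤ ((H - 1 : ℕ) : ℝ) / d := Nat.cast_div_le
      _ ≤ H / d := by
          gcongr
          exact_mod_cast Nat.sub_le H 1
  have hLge : (H : ℝ) / d - 2 ≤ L := by
    have h1 := sub_one_le_natDiv (H - 1) hd0
    have h2 : (((H - 1 : ℕ)) : ℝ) = H - 1 := by push_cast [hH1]; ring
    rw [h2, ← hLdef] at h1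
    have h3 : (H : ℝ) / d - 1 ≤ ((H : ℝ) - 1) / d := by
      rw [sub_div]
      have : (1 : ℝ) / d ≤ 1 := by rw [div_le_one (by positivity)]; exact hd1
      linarith
    linarith
  have hLH : L + 1 ≤ H := by
    have : L ≤ H - 1 := by rw [hLdef]; exact Nat.div_le_self _ _
    omega
  have hdL : d * L ≤ H - 1 := by rw [hLdef]; exact Nat.mul_div_le (H - 1) d
  obtain ⟨N, hNdef⟩ : ∃ N : ℕ, N = (X + d - 1) / d := ⟨_, rfl⟩
  have hdN : d * N ≤ X + d - 1 := by rw [hNdef]; exact Nat.mul_div_le (X + d - 1) d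
  obtain ⟨M₀, hM₀⟩ : ∃ M₀ : ℕ, M₀ = ⌈(X : ℝ) / W ^ 3⌉₊ := ⟨_, rfl⟩
  have hM₀1 : 1 ≤ M₀ := by rw [hM₀, Nat.one_le_ceil_iff]; positivity
  have hM₀ge : (X : ℝ) / W ^ 6 ≤ M₀ := by
    calc (X : ℝ) / W ^ 6 ≤ X / W ^ 3 :=
          div_le_div_of_nonneg_left hX0 (by positivity) (pow_le_pow_right₀ hW1 (by norm_num))
      _ ≤ M₀ := by rw [hM₀]; exact Nat.le_ceil _
  have hXW3 : W ^ 3 ≤ (X : ℝ) := by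
    calc W ^ 3 ≤ W ^ 10 := pow_le_pow_right₀ hW1 (by norm_num)
      _ ≤ H := hHW
      _ ≤ X := by linarith
  have hM₀le : (M₀ : ℝ) ≤ 2 * X / W ^ 3 := by
    have h1 : (M₀ : ℝ) < X / W ^ 3 + 1 := by rw [hM₀]; exact Nat.ceil_lt_add_one (by positivity)
    have h2 : (1 : ℝ) ≤ X / W ^ 3 := by rw [le_div_iff₀ (by positivity)]; linarith
    have h3 : 2 * (X : ℝ) / W ^ 3 = X / W ^ 3 + X / W ^ 3 := by ring
    linarith
  obtain ⟨N₂, hN₂def⟩ : ∃ N₂ : ℕ, N₂ = N + L := ⟨_, rfl⟩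
  have hdN₂ : d * N₂ ≤ 2 * X := by
    rw [hN₂def, Nat.mul_add]
    have : H + d ≤ X + 1 := by
      have h1 : (H : ℝ) + d ≤ X + 1 := by linarith
      exact_mod_cast h1
    omega
  have hN₂le : (N₂ : ℝ) ≤ 2 * X / d := by
    rw [le_div_iff₀ hd0r]
    have : ((d * N₂ : ℕ) : ℝ) ≤ ((2 * X : ℕ) : ℝ) := by exact_mod_cast hdN₂
    push_cast at this
    linarith
  have hN₂X : N₂ ≤ 2 * X := le_trans (Nat.le_mul_of_pos_left N₂ hd0) hdN₂
  -- the bound `TB h` for pieces of at most `h` integers, and its saving function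
  set Q₁ : ℝ := (H : ℝ) / W ^ 4 with hQ₁def
  have hQ₁0 : 0 ≤ Q₁ := by positivity
  set κ₂ : ℝ → ℝ := fun t => Real.sqrt (((q : ℝ) * t * Q₁ + t ^ 2) / V ^ 2 + q * t) with hκ₂def
  have hκ₂0 : ∀ t, 0 ≤ κ₂ t := fun t => Real.sqrt_nonneg _
  set TB : ℕ → ℝ := fun h => (q : ℝ) * ((((h : ℝ) - 1 + 2 * q)) * M₀ +
    2 * Real.sqrt C * κ₂ ((h : ℝ) - 1 + 2 * q) * N₂) with hTBdef
  have hTB0 : ∀ h : ℕ, 1 ≤ h → 0 ≤ TB h := by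
    intro h hh
    have : (0 : ℝ) ≤ (h : ℝ) - 1 + 2 * q := by
      have : (1 : ℝ) ≤ h := by exact_mod_cast hh
      linarith
    simp only [hTBdef]
    positivity
  -- the pieces of a window `[u, u+n]`
  set G : ℕ → ℕ → ℕ → ℝ := fun h u n =>
    ∑ j ∈ range (n / h + 1), ‖∑ m ∈ Icc (u + j * h) (u + min (j * h + h - 1) n), f m‖ with hGdef
  have hG0 : ∀ h u n, 0 ≤ G h u n := fun h u n => Finset.sum_nonneg fun _ _ => norm_nonneg _
  -- (c) the sum over `k` of the pieces, for a window parameter `n ≤ L`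
  have hsumG : ∀ h : ℕ, 1 ≤ h → h ≤ H → ∀ n : ℕ, n ≤ L →
      ∑ k ∈ Icc 1 X, G h ((k + d - 1) / d) n ≤ (d : ℝ) * (((n / h : ℕ) : ℝ) + 1) * TB h := by
    intro h hh1 hhH n hnL
    have hh0 : 0 < h := hh1
    simp only [hGdef]
    rw [Finset.sum_comm]
    have hj : ∀ j ∈ range (n / h + 1),
        ∑ k ∈ Icc 1 X, ‖∑ m ∈ Icc ((k + d - 1) / d + j * h) ((k + d - 1) / d + min (j * h + h - 1) n), f m‖
          ≤ (d : ℝ) * TB h := by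
      intro j hj
      rw [Finset.mem_range, Nat.lt_succ_iff] at hj
      have hjn : j * h ≤ n := (Nat.mul_le_mul_right h hj).trans (Nat.div_mul_le_self n h)
      obtain ⟨ℓ, hℓ⟩ : ∃ ℓ : ℕ, ℓ = min (j * h + h - 1) n - j * h := ⟨_, rfl⟩
      have hℓh : ℓ + 1 ≤ h := by
        rw [hℓ]
        have : min (j * h + h - 1) n ≤ j * h + h - 1 := min_le_left _ _
        generalize j * h = J at this hjn ⊢
        omega
      have hvℓ : ∀ u : ℕ, u + min (j * h + h - 1) n = (u + j * h) + ℓ := by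
        intro u
        rw [hℓ]
        have : j * h ≤ min (j * h + h - 1) n := le_min (by generalize j * h = J; omega) hjn
        omega
      simp only [hvℓ]
      -- factor `d` from `k ↦ ⌈k/d⌉`
      have hceil := sum_Icc_ceilDiv_le hd0 X (fun v => ‖∑ m ∈ Icc (v + j * h) (v + j * h + ℓ), f m‖)
        fun _ => norm_nonneg _
      rw [← hNdef] at hceil
      refine hceil.trans (mul_le_mul_of_nonneg_left ?_ (Nat.cast_nonneg _))
      -- shift by `jh ≤ n`: window starts `w = v + jh ≤ N + n`
      have hshift : ∑ v ∈ Icc 1 N, ‖∑ m ∈ Icc (v + j * h) (v + j * h + ℓ), f m‖ ≤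
          ∑ w ∈ Icc 1 (N + n), ‖∑ m ∈ Icc w (w + ℓ), f m‖ := by
        rw [← Finset.sum_image (s := Icc 1 N) (g := fun v => v + j * h)
          (f := fun w => ‖∑ m ∈ Icc w (w + ℓ), f m‖) (fun x _ y _ hxy => by simpa using hxy)]
        refine Finset.sum_le_sum_of_subset_of_nonneg ?_ (fun _ _ _ => norm_nonneg _)
        intro w hw
        rw [Finset.mem_image] at hw
        obtain ⟨v, hv, rfl⟩ := hw
        rw [Finset.mem_Icc] at hv ⊢
        generalize j * h = J at hjn ⊢
        omega
      refine hshift.trans ?_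
      simp only [hPf]
      -- the twisted window sums of length `ℓ + 1 ≤ h` up to `N + n ≤ N₂`
      have hU := sum_twistedWindow_le33 (q := q) (N := N + n) (M₀ := M₀) (H := H) (j := ℓ) (a := a)
        (C := C) (V := V) (Q₁ := Q₁) S hq0 hS hV0 hC hQ₁0 hM₀1 (by omega)
        (fun c hc χ h' hh'1 hh'H Y hY1 hY2 => by
          have hY1' : (X : ℝ) / W ^ 6 ≤ Y := hM₀ge.trans (by exact_mod_cast hY1)
          have hY2' : Y ≤ 2 * X := by rw [hN₂def] at hN₂X; omega
          exact h34 c hc χ h' hh'1 hh'H Y hY1' hY2')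
      refine hU.trans ?_
      -- monotonicity in the length (`ℓ ≤ h - 1`) and in the range (`N + n ≤ N₂`)
      simp only [hTBdef]
      refine mul_le_mul_of_nonneg_left ?_ (Nat.cast_nonneg _)
      have hℓr : (ℓ : ℝ) ≤ (h : ℝ) - 1 := by
        have : ((ℓ + 1 : ℕ) : ℝ) ≤ h := by exact_mod_cast hℓh
        push_cast at this; linarith
      have hNn : (((N + n : ℕ)) : ℝ) ≤ N₂ := by rw [hN₂def]; exact_mod_cast Nat.add_le_add_left hnL N
      have hs0 : (0 : ℝ) ≤ (ℓ : ℝ) + 2 * q := by positivity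
      have hst : (ℓ : ℝ) + 2 * q ≤ (h : ℝ) - 1 + 2 * q := by linarith
      have hκle : κ₂ ((ℓ : ℝ) + 2 * q) ≤ κ₂ ((h : ℝ) - 1 + 2 * q) := by
        simp only [hκ₂def]
        exact kappa2_mono hq0r.le hQ₁0 hs0 hst
      have e : Real.sqrt (((q : ℝ) * (ℓ + 2 * q) * Q₁ + ((ℓ : ℝ) + 2 * q) ^ 2) / V ^ 2 + q * (ℓ + 2 * q)) =
          κ₂ ((ℓ : ℝ) + 2 * q) := by simp only [hκ₂def]
      rw [e]
      refine add_le_add (mul_le_mul_of_nonneg_right hst (Nat.cast_nonneg _)) ?_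
      exact mul_le_mul (mul_le_mul_of_nonneg_left hκle (by positivity)) hNn (Nat.cast_nonneg _)
        (by positivity)
    refine (Finset.sum_le_sum hj).trans (le_of_eq ?_)
    rw [Finset.sum_const, Finset.card_range, nsmul_eq_mul]
    push_cast
    ring
  -- the general claim for a sub-window length `1 ≤ h ≤ H`
  have hclaim : ∀ h : ℕ, 1 ≤ h → h ≤ H →
      ∑ k ∈ Icc 1 X, ‖∑ m ∈ (windowDiv d H k).filter S,
          ((liouville m : ℤ) : ℂ) * (𝐞 ((m : ℝ) * (a / q + θ)) : ℂ)‖ ≤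
        (d : ℝ) * ((((L - 1) / h : ℕ) : ℝ) + 1 + (((L / h : ℕ)) : ℝ) + 1) * TB h +
          (X : ℝ) * ((((L / h : ℕ)) : ℝ) + 1) * ((h : ℝ) * (2 * Real.pi * h * |θ|)) := by
    intro h hh1 hhH
    have hh0 : 0 < h := hh1
    set err : ℝ := ((((L / h : ℕ)) : ℝ) + 1) * ((h : ℝ) * (2 * Real.pi * h * |θ|)) with herr
    have herr0 : 0 ≤ err := by positivity
    -- (a) each window
    have hterm : ∀ k ∈ Icc 1 X,
        ‖∑ m ∈ (windowDiv d H k).filter S,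
            ((liouville m : ℤ) : ℂ) * (𝐞 ((m : ℝ) * (a / q + θ)) : ℂ)‖ ≤
          G h ((k + d - 1) / d) (L - 1) + G h ((k + d - 1) / d) L + err := by
      intro k hk
      have hk1 : 1 ≤ k := (Finset.mem_Icc.mp hk).1
      have hRHS0 : 0 ≤ G h ((k + d - 1) / d) (L - 1) + G h ((k + d - 1) / d) L + err :=
        add_nonneg (add_nonneg (hG0 _ _ _) (hG0 _ _ _)) herr0
      rw [windowDiv_eq_Icc hd0 hk1]
      obtain ⟨m₀, hm₀⟩ : ∃ m₀ : ℕ, m₀ = (k + d - 1) / d := ⟨_, rfl⟩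
      obtain ⟨M, hM⟩ : ∃ M : ℕ, M = (k + H - 1) / d := ⟨_, rfl⟩
      rw [← hm₀, ← hM]
      by_cases hle : m₀ ≤ M
      · obtain ⟨n, hn⟩ := Nat.exists_eq_add_of_le hle
        -- `n ∈ {L-1, L}`
        have hnL : n ≤ L ∧ L ≤ n + 1 := by
          have e₁ := Nat.div_add_mod (k + d - 1) d
          have r₁ := Nat.mod_lt (k + d - 1) hd0
          have e₂ := Nat.div_add_mod (k + H - 1) d
          have r₂ := Nat.mod_lt (k + H - 1) hd0
          have e₃ := Nat.div_add_mod (H - 1) d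
          have r₃ := Nat.mod_lt (H - 1) hd0
          rw [← hm₀] at e₁
          rw [← hM, hn, Nat.mul_add] at e₂
          rw [← hLdef] at e₃
          have g1 : d * n < d * (L + 1) := by
            rw [Nat.mul_add, Nat.mul_one]
            generalize d * m₀ = A at e₁ e₂
            generalize d * n = B at e₂
            generalize d * L = E at e₃
            omega
          have g2 : d * L < d * (n + 2) := by
            rw [Nat.mul_add]
            generalize d * m₀ = A at e₁ e₂
            generalize d * n = B at e₂
            generalize d * L = E at e₃
            omega
          exact ⟨Nat.lt_succ_iff.mp (Nat.lt_of_mul_lt_mul_left g1),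
            by have := Nat.lt_of_mul_lt_mul_left g2; omega⟩
        rw [hn, hrew]
        refine (norm_sum_window_le_pieces f hf1 θ m₀ n hh0).trans ?_
        have h1 : G h m₀ n ≤ G h m₀ (L - 1) + G h m₀ L := by
          rcases Nat.eq_or_lt_of_le hnL.1 with h' | h'
          · rw [h']; linarith [hG0 h m₀ (L - 1)]
          · have : n = L - 1 := by omega
            rw [this]; linarith [hG0 h m₀ L]
        have h2 : (((n / h : ℕ)) + 1 : ℝ) * ((h : ℝ) * (2 * Real.pi * h * |θ|)) ≤ err := by
          rw [herr]
          refine mul_le_mul_of_nonneg_right ?_ (by positivity)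
          have : ((n / h : ℕ) : ℝ) ≤ ((L / h : ℕ) : ℝ) := by exact_mod_cast Nat.div_le_div_right hnL.1
          linarith
        have e : ∑ j ∈ range (n / h + 1), ‖∑ m ∈ Icc (m₀ + j * h) (m₀ + min (j * h + h - 1) n), f m‖ =
            G h m₀ n := by simp only [hGdef]
        rw [e]
        rw [hm₀] at h1 ⊢
        linarith
      · -- empty window
        have hempty : Icc m₀ M = ∅ := Finset.Icc_eq_empty_of_lt (by omega)
        rw [hempty, Finset.filter_empty, Finset.sum_empty, norm_zero]
        subst hm₀
        exact hRHS0
    -- (b) sum over `k`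
    refine (Finset.sum_le_sum hterm).trans ?_
    rw [Finset.sum_add_distrib, Finset.sum_add_distrib, Finset.sum_const, Nat.card_Icc,
      Nat.add_sub_cancel, nsmul_eq_mul]
    have hs1 := hsumG h hh1 hhH (L - 1) (Nat.sub_le L 1)
    have hs2 := hsumG h hh1 hhH L le_rfl
    have e : (d : ℝ) * ((((L - 1) / h : ℕ) : ℝ) + 1 + (((L / h : ℕ)) : ℝ) + 1) * TB h =
        (d : ℝ) * ((((L - 1) / h : ℕ) : ℝ) + 1) * TB h + (d : ℝ) * ((((L / h : ℕ)) : ℝ) + 1) * TB h := by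
      ring
    rw [e, herr]
    have e2 : (X : ℝ) * (((((L / h : ℕ)) : ℝ) + 1) * ((h : ℝ) * (2 * Real.pi * h * |θ|))) =
        (X : ℝ) * ((((L / h : ℕ)) : ℝ) + 1) * ((h : ℝ) * (2 * Real.pi * h * |θ|)) := by ring
    linarith
  -- the saving `κ₂` squares to the printed expression
  have hκsq : ∀ t : ℝ, 0 ≤ t → κ₂ t ^ 2 = ((q : ℝ) * t * Q₁ + t ^ 2) / V ^ 2 + q * t := by
    intro t ht
    simp only [hκ₂def]
    rw [Real.sq_sqrt (by positivity)]
  have hθ0 : 0 ≤ |θ| := abs_nonneg θ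
  -- the two cases
  by_cases hcase : |θ| * H ≤ d / R
  · -- Case A: a single piece per window, `h = L + 1`
    have hh1 : 1 ≤ L + 1 := by omega
    have key := hclaim (L + 1) hh1 hLH
    have e1 : (L - 1) / (L + 1) = 0 := Nat.div_eq_of_lt (by omega)
    have e2 : L / (L + 1) = 0 := Nat.div_eq_of_lt (by omega)
    rw [e1, e2] at key
    simp only [Nat.cast_zero, zero_add] at key
    refine key.trans ?_
    obtain ⟨c1, c2, c3, c4⟩ := majorArc33_coeffsA (hh := ((L + 1 : ℕ) : ℝ)) (θa := |θ|) hW hR1 hR3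
      hd1 hdW hq1 hqW hHW hLreal hLge (by push_cast; ring) hθ0 hcase
    have hnum := majorArc33_numerics (C := C) (X := (X : ℝ)) (M₀r := (M₀ : ℝ)) (N₂r := (N₂ : ℝ))
      (κ := κ₂ (((L + 1 : ℕ) : ℝ) - 1 + 2 * q)) (Φ' := 2) (Φ'' := 1)
      hW hR1 hR3 hV0 hV hd1 hdW hq1 hqW hHW hHX (by exact_mod_cast hh1) c4
      (by norm_num) c1 c2 c3 (Nat.cast_nonneg _) hM₀le hN₂le
      (hκ₂0 _) (le_of_eq (hκsq _ (by push_cast; linarith [Nat.cast_nonneg (α := ℝ) L])))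
    refine le_trans (le_of_eq ?_) hnum
    simp only [hTBdef]
    ring
  · -- Case B: pieces of `h = ⌊1/(R|θ|)⌋` integers
    push Not at hcase
    have hθpos : 0 < |θ| := by
      rcases eq_or_lt_of_le hθ0 with h | h
      · rw [← h, zero_mul] at hcase
        have : 0 ≤ (d : ℝ) / R := by positivity
        linarith
      · exact h
    obtain ⟨-, hRW, -, -, -, -, -, -, -, h4RW4, -⟩ := majorArc33_powers hW hR1 hR3 hdW hqW hHW
    -- `ρ = 1/(R|θ|) ≥ qH/(RW⁴) ≥ 2`
    set ρ : ℝ := 1 / (R * |θ|) with hρ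
    have hρge : (q : ℝ) * H / (R * W ^ 4) ≤ ρ := by
      rw [hρ, div_le_div_iff₀ (by positivity) (by positivity), one_mul]
      have h1 : |θ| * ((q : ℝ) * H) ≤ W ^ 4 := by
        have := mul_le_mul_of_nonneg_right hθ (by positivity : (0 : ℝ) ≤ q * H)
        rwa [div_mul_cancel₀ _ (by positivity)] at this
      nlinarith
    have hρ2 : 2 ≤ ρ := by
      refine le_trans ?_ hρge
      rw [le_div_iff₀ (by positivity)]
      calc 2 * (R * W ^ 4) = (4 * R * W ^ 4) / 2 := by ring
        _ ≤ (H : ℝ) / 2 := by linarith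
        _ ≤ q * H := by nlinarith
    obtain ⟨h, hhdef⟩ : ∃ h : ℕ, h = ⌊ρ⌋₊ := ⟨_, rfl⟩
    have hρ0 : 0 ≤ ρ := by linarith
    have hhle : (h : ℝ) ≤ ρ := by rw [hhdef]; exact Nat.floor_le hρ0
    have hhgt : ρ < h + 1 := by rw [hhdef]; exact Nat.lt_floor_add_one ρ
    have hh1 : 1 ≤ h := by
      rw [hhdef]; exact Nat.le_floor (by norm_num; linarith)
    have hh1r : (1 : ℝ) ≤ h := by exact_mod_cast hh1
    -- `h ≤ ρ < H/d`
    have hρlt : ρ < (H : ℝ) / d := by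
      rw [hρ, div_lt_div_iff₀ (by positivity) hd0r, one_mul]
      have h' : (d : ℝ) < |θ| * H * R := (div_lt_iff₀ hR0).mp hcase
      linarith
    have hhH' : (h : ℝ) ≤ H / d := by linarith
    have hhH : h ≤ H := by
      have h1 : (h : ℝ) ≤ H := hhH'.trans (div_le_self (by positivity) hd1)
      exact_mod_cast h1
    have hhθ : (h : ℝ) * |θ| ≤ 1 / R := by
      calc (h : ℝ) * |θ| ≤ ρ * |θ| := mul_le_mul_of_nonneg_right hhle hθ0
        _ = 1 / R := by rw [hρ]; field_simp
    have hhlo : (q : ℝ) * H / (2 * R * W ^ 4) ≤ h := by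
      have h1 : (q : ℝ) * H / (2 * R * W ^ 4) = ((q : ℝ) * H / (R * W ^ 4)) / 2 := by
        field_simp
      rw [h1]
      linarith
    have key := hclaim h hh1 hhH
    refine key.trans ?_
    obtain ⟨c1, c2, c3, c4⟩ := majorArc33_coeffsB (ℓr := (L : ℝ)) (hh := (h : ℝ)) (θa := |θ|) hW hR1 hR3
      hd1 hdW hq1 hqW hHW (Nat.cast_nonneg L) hLreal hh1r hhH' hθ0 hhθ hhlo
    have hnum := majorArc33_numerics (C := C) (X := (X : ℝ)) (M₀r := (M₀ : ℝ)) (N₂r := (N₂ : ℝ))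
      (κ := κ₂ ((h : ℝ) - 1 + 2 * q)) (Φ' := 2 * (L : ℝ) / h + 2) (Φ'' := (L : ℝ) / h + 1)
      hW hR1 hR3 hV0 hV hd1 hdW hq1 hqW hHW hHX hh1r c4
      (by positivity) c1 c2 c3 (Nat.cast_nonneg _) hM₀le hN₂le
      (hκ₂0 _) (le_of_eq (hκsq _ (by linarith)))
    refine le_trans ?_ hnum
    -- the integer-division coefficients are at most the real ones
    have hTBh := hTB0 h hh1
    have hd1' : ((((L - 1) / h : ℕ)) : ℝ) ≤ (L : ℝ) / h := by
      calc ((((L - 1) / h : ℕ)) : ℝ) ≤ (((L - 1 : ℕ)) : ℝ) / h := Nat.cast_div_le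
        _ ≤ (L : ℝ) / h := by
            gcongr
            exact_mod_cast Nat.sub_le L 1
    have hd2' : (((L / h : ℕ)) : ℝ) ≤ (L : ℝ) / h := Nat.cast_div_le
    have hco1 : ((((L - 1) / h : ℕ)) : ℝ) + 1 + (((L / h : ℕ)) : ℝ) + 1 ≤ 2 * (L : ℝ) / h + 2 := by
      rw [mul_div_assoc]; linarith
    have hco2 : (((L / h : ℕ)) : ℝ) + 1 ≤ (L : ℝ) / h + 1 := by linarith
    have herr0 : 0 ≤ (h : ℝ) * (2 * Real.pi * h * |θ|) := by positivity
    have t1 := mul_le_mul_of_nonneg_right (mul_le_mul_of_nonneg_left hco1 (Nat.cast_nonneg d)) hTBh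
    have t2 := mul_le_mul_of_nonneg_right (mul_le_mul_of_nonneg_left hco2 hX0) herr0
    simp only [hTBdef] at t1 ⊢
    linarith


/-! ### Proposition 3.2 (weak form) at the printed first exponent -/

/-- Eventually `2H ≤ X` in the printed regime (`H ≤ exp((log X)^{3/4})`). [folklore] -/
theorem eventually_two_mul_H_le {H : ℕ → ℕ}
    (hψ : ∀ᶠ X : ℕ in atTop, Real.log (H X) / Real.log (Real.log X) ≤ Real.log X ^ (2 / 3 : ℝ)) :
    ∀ᶠ X : ℕ in atTop, 2 * (H X : ℝ) ≤ X := by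
  filter_upwards [eventually_H_le_exp_of_psi hψ (e := 3 / 4) (by norm_num),
    tendsto_log_natCast.eventually_ge_atTop (64 : ℝ),
    eventually_small_terms (Real.log 2) 0 (show (3 / 4 : ℝ) < 1 by norm_num) (show (3 / 4 : ℝ) < 1 by norm_num)
      one_pos] with X hHX hL hsm
  have h := exp_form_gen hL (k := Real.log 2) (a := 3 / 4) (b := 0) (by
    have : 0 ≤ Real.log (X : ℝ) ^ (3 / 4 : ℝ) := Real.rpow_nonneg (by linarith) _
    linarith)
  rw [Real.exp_log (by norm_num : (0 : ℝ) < 2), Real.rpow_zero, mul_one] at h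
  calc 2 * (H X : ℝ) ≤ 2 * Real.exp (Real.log X ^ (3 / 4 : ℝ)) := by linarith
    _ = Real.exp (Real.log 2) * Real.exp (Real.log X ^ (3 / 4 : ℝ)) := by
        rw [Real.exp_log (by norm_num : (0 : ℝ) < 2)]
    _ ≤ X := by rw [Real.exp_log (by norm_num : (0 : ℝ) < 2)]; exact h

end Literature.NumberTheory.Sieve.Lichtman2020

namespace Literature.NumberTheory.Sieve

open Filter Asymptotics Finset MeasureTheory
open scoped FourierTransform Topology

-- long but linear assembly (eventual side conditions, discretisation, the fixed-`X` bound)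
set_option maxHeartbeats 800000 in
open Lichtman2020 ArithmeticFunction in
/-- **Lichtman 2020, the major arcs at the printed first exponent (weak Proposition 3.2), from the
mean-square bound of `MoebiusShiftedPrimesMeanSquare33.lean`**, stated with that bound as the
hypothesis `h34` (the conclusion of `Lichtman2020.liouvilleMeanSquare33` for these `c, A, δ, H`):
eventually in `X`, for `1 ≤ d ≤ W = (log X)^A` and `α ∈ 𝔐` (`α = a/q + θ`, `q ≤ W`,
`|θ| ≤ W⁴/(qH)`), `∫₀^X |∑_{x ≤ nd ≤ x+H, n ∈ S_c} λ(n)e(nα)| dx ≤ C · HX/(d (log X)^{A/5})`.  The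
integral is the finite sum over `k ≤ X` (`integral_window_div_eq_sum`), bounded by
`majorArc_fixed_bound33` with `R = (log X)^{A/5}`, `V = (log X)^{3A/2}`; its inputs hold eventually
(`W^{10} ≤ H`, `2H ≤ X`, `S_c(c'm) ↔ S_c(m)` for `c' ∣ q` as `c' ≤ W < P₁, P₂`), and `h34` is
discretised on the integer blocks `(Y, 2Y]` by `integral_window_eq_sum_Ioc`.
[cite: Lichtman2020, Proposition 3.2] -/
theorem Lichtman2020.majorArc33_of {c A δ : ℝ} {H : ℕ → ℕ} (hc : 33 ≤ c) (hA : 5 < A) (hδ : 0 < δ)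
    (hH : Tendsto (fun X : ℕ => Real.log (H X) / Real.log (Real.log X)) atTop atTop)
    (hψ : ∀ᶠ X : ℕ in atTop, Real.log (H X) / Real.log (Real.log X) ≤ Real.log X ^ (2 / 3 : ℝ))
    (h34 : ∃ C : ℝ, ∀ᶠ X : ℕ in atTop, ∀ q : ℕ, 1 ≤ q → (q : ℝ) ≤ Real.log X ^ A →
      ∀ χ : DirichletCharacter ℂ q, ∀ h : ℕ, 1 ≤ h → h ≤ H X →
        ∀ Y : ℝ, (X : ℝ) / Real.log X ^ (6 * A) ≤ Y → Y ≤ 2 * X →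
          ∫ x in Y..2 * Y,
              ‖∑ m ∈ (Icc ⌈x⌉₊ ⌊x + h⌋₊).filter (lichtmanTypicalWith c X A δ (H X)),
                  ((liouville m : ℤ) : ℂ) * χ (m : ZMod q)‖ ^ 2
            ≤ C * ((h : ℝ) ^ 2 * Y * ((H X : ℝ) / Real.log X ^ (4 * A) / h + 1) / Real.log X ^ (3 * A)
              + h * Y)) :
    ∃ C : ℝ, ∀ᶠ X : ℕ in atTop, ∀ d : ℕ, 1 ≤ d → (d : ℝ) ≤ Real.log X ^ A →
      ∀ α ∈ lichtmanMajorArcs (Real.log X ^ A) ((H X : ℝ) / Real.log X ^ (4 * A)),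
        ∫ x in (0 : ℝ)..X,
            ‖liouvilleTwistedSum
                ((Icc ⌈x / d⌉₊ ⌊(x + H X) / d⌋₊).filter (lichtmanTypicalWith c X A δ (H X))) α‖
          ≤ C * ((H X : ℝ) * X / (d * Real.log X ^ (A / 5))) := by
  have hA0 : 0 < A := by linarith
  obtain ⟨C, hC⟩ := h34
  obtain ⟨C', hC'⟩ : ∃ C' : ℝ, C' = max C 0 := ⟨_, rfl⟩
  have hC'0 : 0 ≤ C' := by rw [hC']; exact le_max_right _ _
  have hCC' : C ≤ C' := by rw [hC']; exact le_max_left _ _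
  refine ⟨16 + 8 * Real.pi + 52 * Real.sqrt C', ?_⟩
  -- eventual inequalities
  have hW2 : ∀ᶠ X : ℕ in atTop, 2 ≤ Real.log X ^ A :=
    ((tendsto_rpow_atTop hA0).comp tendsto_log_natCast).eventually_ge_atTop 2
  have hH10 : ∀ᶠ X : ℕ in atTop, Real.log X ^ (10 * A) ≤ H X := eventually_rpow_log_le_H hH (10 * A)
  have hP2 : ∀ᶠ X : ℕ in atTop, Real.log X ^ A < Real.exp (Real.log X ^ (2 / 3 + δ / 2)) := by
    filter_upwards [eventually_sqrtW_lt_P2 (2 * A) δ hδ] with X hX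
    rwa [show 2 * A / 2 = A by ring] at hX
  have hlog1 : ∀ᶠ X : ℕ in atTop, 1 < Real.log X := tendsto_log_natCast.eventually_gt_atTop 1
  filter_upwards [hC, hW2, hH10, eventually_two_mul_H_le hψ, hP2, hlog1, eventually_ge_atTop 1]
    with X hCX hW2X hH10X hHX2 hP2X hlog1X hX1 d hd hdW α hα
  have hL0 : 0 < Real.log X := by linarith
  have hL1 : 1 ≤ Real.log X := hlog1X.le
  -- powers of `W = (log X)^A`
  have hpow : ∀ n : ℕ, Real.log X ^ ((n : ℝ) * A) = (Real.log X ^ A) ^ n := fun n => by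
    rw [mul_comm, Real.rpow_mul hL0.le, Real.rpow_natCast]
  have h4 : Real.log X ^ (4 * A) = (Real.log X ^ A) ^ 4 := by exact_mod_cast hpow 4
  have h6 : Real.log X ^ (6 * A) = (Real.log X ^ A) ^ 6 := by exact_mod_cast hpow 6
  have h10 : Real.log X ^ (10 * A) = (Real.log X ^ A) ^ 10 := by exact_mod_cast hpow 10
  rw [h10] at hH10X
  set W : ℝ := Real.log X ^ A with hWdef
  have hW0 : 0 < W := by linarith
  have hW1 : 1 ≤ W := by linarith
  -- `R = W^{1/5}`, `V = W^{3/2}`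
  set R : ℝ := Real.log X ^ (A / 5) with hRdef
  have hR1 : 1 ≤ R := Real.one_le_rpow hL1 (by positivity)
  have hR3 : R ^ 3 ≤ W := by
    have e : R ^ 3 = Real.log X ^ (3 * A / 5) := by
      rw [hRdef, ← Real.rpow_natCast, ← Real.rpow_mul hL0.le]; ring_nf
    rw [e, hWdef]
    exact Real.rpow_le_rpow_of_exponent_le hL1 (by linarith)
  set V : ℝ := Real.log X ^ (3 * A / 2) with hVdef
  have hV0 : 0 < V := Real.rpow_pos_of_pos hL0 _
  have hV2 : V ^ 2 = Real.log X ^ (3 * A) := by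
    rw [hVdef, ← Real.rpow_natCast, ← Real.rpow_mul hL0.le]; ring_nf
  have hWV : W ^ 3 ≤ V ^ 2 := by
    rw [hV2, hWdef, ← Real.rpow_natCast, ← Real.rpow_mul hL0.le]
    ring_nf; rfl
  have hHX0 : (0 : ℝ) < H X := lt_of_lt_of_le (by positivity) hH10X
  -- the major arc datum `α = a/q + θ`
  simp only [lichtmanMajorArcs, lichtmanMajorArc, Set.mem_iUnion, Set.mem_setOf_eq] at hα
  obtain ⟨q, ⟨hq1, hqW⟩, a, -, hθ'⟩ := hα
  have hq0 : (0 : ℝ) < q := by exact_mod_cast hq1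
  obtain ⟨θ, hθdef⟩ : ∃ θ : ℝ, θ = α - a / q := ⟨_, rfl⟩
  have hαθ : (a : ℝ) / q + θ = α := by rw [hθdef]; ring
  have hθ : |θ| ≤ W ^ 4 / (q * H X) := by
    rw [h4] at hθ'
    rw [hθdef]
    calc |α - a / q| ≤ 1 / (q * (H X / W ^ 4)) := hθ'
      _ = W ^ 4 / (q * H X) := by field_simp
  -- the integral is a finite sum over `k ≤ X`
  rw [integral_window_div_eq_sum
    (fun s => ‖liouvilleTwistedSum (s.filter (lichtmanTypicalWith c X A δ (H X))) α‖) X (H X) d hd]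
  -- `S(c'm) ↔ S(m)` for `c' ∣ q`
  have hS : ∀ c' ∈ q.divisors, ∀ m,
      lichtmanTypicalWith c X A δ (H X) (c' * m) ↔ lichtmanTypicalWith c X A δ (H X) m := by
    intro c' hc' m
    have hc0 : c' ≠ 0 := (Nat.pos_of_mem_divisors hc').ne'
    have hcW : (c' : ℝ) ≤ W := le_trans (by exact_mod_cast Nat.divisor_le hc') hqW
    have hp : ∀ p ∈ c'.primeFactors, (p : ℝ) ≤ W := fun p hp =>
      le_trans (by exact_mod_cast Nat.le_of_mem_primeFactors hp) hcW
    have hWP1 : W < Real.log X ^ (c * A) :=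
      Real.rpow_lt_rpow_of_exponent_lt hlog1X (by nlinarith)
    unfold lichtmanTypicalWith
    rw [hasPrimeFactorIn_mul_iff hc0 (fun p hp' => (hp p hp').trans_lt hWP1),
      hasPrimeFactorIn_mul_iff hc0 (fun p hp' => (hp p hp').trans_lt hP2X)]
  -- the mean-square bound for the moduli `q/c'`, discretised
  have h34d : ∀ c' ∈ q.divisors, ∀ χ : DirichletCharacter ℂ (q / c'), ∀ h : ℕ,
      1 ≤ h → h ≤ H X → ∀ Y : ℕ, (X : ℝ) / W ^ 6 ≤ Y → Y ≤ 2 * X →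
        ∑ k ∈ Ioc Y (2 * Y), ‖∑ m ∈ (Icc k (k + h - 1)).filter (lichtmanTypicalWith c X A δ (H X)),
            χ (m : ZMod (q / c')) * ((liouville m : ℤ) : ℂ)‖ ^ 2 ≤
          C' * ((h : ℝ) ^ 2 * Y * ((H X : ℝ) / W ^ 4 / h + 1) / V ^ 2 + h * Y) := by
    intro c' hc' χ h hh1 hh2 Y hY1 hY2
    have hc0 : 0 < c' := Nat.pos_of_mem_divisors hc'
    have hcq : c' ∣ q := Nat.dvd_of_mem_divisors hc'
    have hq'1 : 1 ≤ q / c' := Nat.div_pos (Nat.le_of_dvd hq1 hcq) hc0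
    have hq'W : ((q / c' : ℕ) : ℝ) ≤ W := le_trans (by exact_mod_cast Nat.div_le_self q c') hqW
    have hY1' : (X : ℝ) / Real.log X ^ (6 * A) ≤ (Y : ℝ) := by rwa [h6]
    have hY2' : ((Y : ℕ) : ℝ) ≤ 2 * X := by exact_mod_cast hY2
    have hint := hCX (q / c') hq'1 hq'W χ h hh1 hh2 Y hY1' hY2'
    rw [h4, ← hV2] at hint
    have hYpos : 0 < Y := by
      have hXpos : (0 : ℝ) < X := by exact_mod_cast hX1
      have : (0 : ℝ) < Y := lt_of_lt_of_le (div_pos hXpos (pow_pos hW0 6)) hY1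
      exact_mod_cast this
    have hdisc := integral_window_eq_sum_Ioc (fun s => ‖∑ m ∈ s.filter (lichtmanTypicalWith c X A δ (H X)),
        ((liouville m : ℤ) : ℂ) * χ (m : ZMod (q / c'))‖ ^ 2) Y (2 * Y) h (by omega) hh1
    have hcast : ((2 * Y : ℕ) : ℝ) = 2 * (Y : ℝ) := by push_cast; ring
    rw [hcast] at hdisc
    rw [hdisc] at hint
    have hcomm : ∀ s : Finset ℕ, ∑ m ∈ s, χ (m : ZMod (q / c')) * ((liouville m : ℤ) : ℂ) =
        ∑ m ∈ s, ((liouville m : ℤ) : ℂ) * χ (m : ZMod (q / c')) :=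
      fun s => Finset.sum_congr rfl fun m _ => mul_comm _ _
    simp only [hcomm]
    exact hint.trans (mul_le_mul_of_nonneg_right hCC' (by positivity))
  -- the bound at the fixed scale `X`
  have hcore := majorArc_fixed_bound33 (X := X) (H := H X) (d := d) (q := q) (a := a) (θ := θ)
    (W := W) (V := V) (R := R) (C := C') (lichtmanTypicalWith c X A δ (H X)) hX1 hd hdW hq1 hqW hW2X
    hR1 hR3 hV0 hWV hH10X hHX2 hθ hC'0 hS h34d
  rw [hαθ] at hcore
  simp only [liouvilleTwistedSum]
  exact hcore

/-- **Lichtman 2020, the major arcs at the printed first exponent (weak Proposition 3.2)** — PROVED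
from the named facts Lemma 4.5 (`Lichtman2020_primeCharacterSum`) and Lemma 4.8
(`Lichtman2020_liouvilleCharacterSifted`, proved in the tree): for `c ≥ 33`, `A > 5`, `δ > 0`,
`ψ → ∞`, `ψ(X) ≤ (log X)^{2/3}`, eventually in `X`, for `1 ≤ d ≤ (log X)^A` and `α` in the printed
major arcs, `∫₀^X |∑_{x ≤ nd ≤ x+H, n ∈ S_c} λ(n) e(nα)| dx ≤ C · HX/(d (log X)^{A/5})`.
[cite: Lichtman2020, Proposition 3.2] -/
theorem Lichtman2020.majorArc33 (h45 : Lichtman2020_primeCharacterSum)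
    (h48 : Lichtman2020_liouvilleCharacterSifted) :
    ∀ c : ℝ, 33 ≤ c → ∀ A : ℝ, 5 < A → ∀ δ : ℝ, 0 < δ → ∀ H : ℕ → ℕ,
    Tendsto (fun X : ℕ => Real.log (H X) / Real.log (Real.log X)) atTop atTop →
    (∀ᶠ X : ℕ in atTop, Real.log (H X) / Real.log (Real.log X) ≤ Real.log X ^ (2 / 3 : ℝ)) →
    ∃ C : ℝ, ∀ᶠ X : ℕ in atTop, ∀ d : ℕ, 1 ≤ d → (d : ℝ) ≤ Real.log X ^ A →
      ∀ α ∈ lichtmanMajorArcs (Real.log X ^ A) ((H X : ℝ) / Real.log X ^ (4 * A)),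
        ∫ x in (0 : ℝ)..X,
            ‖liouvilleTwistedSum
                ((Icc ⌈x / d⌉₊ ⌊(x + H X) / d⌋₊).filter (lichtmanTypicalWith c X A δ (H X))) α‖
          ≤ C * ((H X : ℝ) * X / (d * Real.log X ^ (A / 5))) :=
  fun c hc A hA δ hδ H hH hψ =>
    Lichtman2020.majorArc33_of hc hA hδ hH hψ (Lichtman2020.liouvilleMeanSquare33 h45 h48 c hc A hA δ hδ H hH hψ)

end Literature.NumberTheory.Sieve
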